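import Literature.MathematicalPhysics.QuantumFieldTheory.Balaban1983to89.B14From190LayerSizes
import Literature.MathematicalPhysics.QuantumFieldTheory.Balaban1983to89.B11Ineq73HasMajConcrete
import Literature.MathematicalPhysics.QuantumFieldTheory.Balaban1983to89.B11Ineq190DerivConcreteC

/-!
# `Balaban1983to89.B14From190ConcreteC` — T. Bałaban, *Convergent renormalization expansions for lattice gauge theories*,
# Commun. Math. Phys. **119** (1988) 243–285 [Balaban1988Convergent] = [III]: the four (190)-knittings of §§1, 3 (pp. 250, 266,
# 268, 269) AT THE CONCRETE REMAINDER `C_j(U₁, ·)` OF [4] ON r08's SINGLE-SCALE CUBE GEOMETRY — (190) itself, the mean-value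
# reading, the (73) majorant, [3] (2.54) and Lemma 2.1 (2.61), and the size ↔ norm letters `hN`/`hBloc` ALL SUPPLIED BY NAME

statement-level skeleton of published theorems with citation tags; proofs where landed; nothing here is a claim
about the Yang–Mills mass gap

CITATION HEADER (lean-in-tree rule 2026-08-18).  T. Bałaban, *Convergent renormalization expansions for lattice gauge
theories*, Commun. Math. Phys. **119**, 243–285 (1988), doi:10.1007/BF01217741, bib `Balaban1988Convergent` (cell paper
B14 = "[III]"; PDF held `paper:balaban1988-cmp119-convergent-renormalization`, journal page = PDF page + 242; pp. 250, 266,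
268, 269 = PDF 8, 24, 26, 27, re-read on the text layer for this file).  "[15]" = T. Bałaban, *The variational problem and
background fields in renormalization group method for lattice gauge theories*, Commun. Math. Phys. **102**, 277–309 (1985),
bib `Balaban1985Variational` (cell paper B11; Prop. 9 p. 309, (190) p. 308, (179)–(180) p. 306, (189) p. 308, (73) and
Prop. 3 p. 289, (44)/(46) p. 285).  "[4]" = [Balaban1985Averaging] (CMP **98**) Props. 4–5 pp. 38–42 (the remainder
`C_j(U₀, ·)`).  "[3]" = [Balaban1984PropagatorsII] Lemma 2.1 (2.61) p. 234 (`B11SectG.RowSum`), (2.54) p. 233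
(`Triangle254`).  Mega-formalization `lit-balaban`, HOME `run/shared/lean/pub/lit-balaban/`, unit `lit-balaban-r11` gen 95
(reader/typer and fold owner of block B14; cell GAPS.md G-B14-08 — this file is its Addendum 5 in the tree: after gen 9's
`B14From190SectG` closed (190) ITSELF and the mean-value reading `hmv` for every (190)-consuming B14 row at the scheme
level, the located leaves (73) `hDfr`, [3] (2.54) `htri`, (2.61) `hrow`/`hrow8`, `hdist`, `hN`, `hBloc` and the Sect. C
letters `hTm`/`hTm0` are discharged too, at the price of fixing the Sect. C datum to the CONCRETE `C_j` of [4] and the block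
geometry to r08's single-scale cube geometry — the [III] twin of r12 gen 12's `B15From190ConcreteC` (p311256/p312211), which
did the same for the [IV] §1 knits, following r08 gen 11's `B11Ineq73HasMajConcrete` (p309726)).

WHAT IS REPRODUCED.  SKELETON rows **B14.Eq3.16–3.19** ((3.18)/(3.19)), **B14.Eq3.21–3.22** (the p. 269 bound on `𝐇^{(k)}`),
**B14.Eq1.18–1.19** (the p. 250 bound), **B14.Claim@265** ((3.7)/(3.8)) — cells only, every head unchanged.  THE PRINT
(verbatim up to OCR; the sentences whose words *"exponential decay property"* cite [15] (190)): p. 268 *"The field U_{k+1}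
satisfies the regularity condition |∂U_{k+1} − 1| < 2B₃ε_{k+1}(L⁻¹η)² on Ω_{k+1}, hence the argument of the function
𝐇_{k+1,□′} is bounded by 44d²B₃ε_{k+1}, and has a support in a boundary layer of the width 2LM₁ at the boundary of □′^{∼4}.
Thus, the function 𝐇_{k+1,□′} is bounded by B₃exp(−δLM₂R_{k+1})44d²B₃ε_{k+1} ≦ 44d²B₃²(1+β₀)exp(−R_k)ε_k on □′^{∼2}, and
[(3.18)] … [(3.19)] = O(1)44d²B₃²(1+β₀)exp(−R_k)δ_k < δ_k"*; p. 266 *"On almost the whole cube □^{∼4}, except a boundary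
layer of the width 2M₁, the field in the argument of the function 𝐇_{k,□} is equal to (1/i)log[V_k(V^{(k)}_{□′})⁻¹], hence it
can be bounded by 4δ_k. On the boundary layer this field can be bounded by 30d²L²B₃(1+β₀)ε_k … By the exponential decay
property (190) [15] we obtain the estimate |𝐇_{k,□}|, |∇^η_{U_{k+1,□′}}𝐇_{k,□}| ≦ B₃(4δ_k + exp(−δ2M₂R_k)30d²L²B₃(1+β₀)ε_k)
< … ε_k on □^∼, (3.7) for A₁/A₀ and γ sufficiently small. This estimate and the equalities (3.7), (1.43) [14] imply
[|U_{k,□}(∂p) − 1|] < 2(1+β₀)L⁻²ε_kη² + … ε_kη² < ε_kη² for p ⊂ □^∼. (3.8)"*; p. 269 *"It yields the representation (3.18)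
with the corresponding changes, e.g., V^{(k)}_{□′} is replaced by V^{(k)}_{Λ^c_{k+1}∩Λ_k}, and with similar bounds. Denoting
[(3.22)] we obtain that 𝐇^{(k)} is an analytic function of the background field U_{k+1} restricted to Λ^c_{k+1}∩Λ_k, bounded
on the set S_{k+1} by O(1)ε_k exp(−R_k)"*; p. 250 *"More precisely |U₁U_{1,□′}⁻¹ − 1| < O(1)B₃·exp(−δLM₂R₁)ε₁, and the
bound can be made much smaller than δ₀, if M₂R₁ is large enough."*  [15] (190) p. 308: *"|(δ/δB_ν(y′))𝓗_μ(B,x)|,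
|∇_x(δ/δB_ν(y′))𝓗_μ(B,x)|, … ≦ O(1)[(L^jη)^{−1}, (L^jη)^{−2}, …]·(L^{j′}η)^{−d}exp(−⅛δ₀d(y,y′)) (190) for x ∈ Δ(y), … y ∈ Λ_j,
y′ ∈ Λ_{j′}"*; (73) p. 289: *"|𝔇(A′; c, b)| ≦ O(1)C₃ε₃(L^jη)^{−d+1}e^{−(1/2)δ₀d(c₋,y)}, b ∈ B^j(y), y ∈ Λ_j"* (read in the
tree in the kernel form of p06's `B11Eq73KernelConcrete`, as in r08's `B11Ineq73HasMajConcrete`); Prop. 3 p. 289; (44) p. 285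
*"The Proposition 4 of [4] implies Q_j(ηA) = L^jηQ_jA + C_j(L^jηA), |C_j(L^jηA)| ≦ C₂(L^jη)²|A|²"*.

THE CHAIN, BY NAME (nothing restated, nothing modified).  r11's layer-level knits `B14From190LayerSizes.ineq319_lt_of_ineq190_layer`
((3.19)), `norm_bH322_le_of_ineq190_layer` (p. 269), `dev119_le_of_ineq190_layer` (p. 250), `ineq38_lt_of_ineq190_layer_scale`
((3.8) at print's scale; gen 7, p269225; input size `supSize g boxB blkB` on the bond index set of p29's towers, B-sizes and
localisations discharged there) take ONE pair of located hypotheses per output size: `h190 : ∀ t, Ineq190 (supSize g boxB blkB)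
(supSize g box blk) (dH t) C δ₀` and the mean-value domination `hmv` (for (3.8) a second pair `h190₁`/`hmv₁` for the
covariant-derivative size `covDerivBlockSize g y₀ S η U₀`).  r08 gen 11's
`B11Ineq73HasMajConcrete.ineq190_and_hmv_supSize_concreteC_kernel` PRODUCES the sup pair for any lattice presentation `ev` of
the (179) chart `𝓗 = chartH179 𝒢 W D2 H₀ (· − H(Dfix(C_j(U₁,·)) ·)) ε₄` at the CONCRETE remainder `C_j(U₁, ·) =
B11Eq44Concrete.Cmap L U₁ S T j` of [4] on `ℤᵈ` (Sect. C selector `D = B11Prop3Model.Dfix` = the solution of (49); Prop. 3's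
inputs = the theorem `B11Prop3Concrete.inputs_concrete`, analyticity of `C_j` = `B12SecondOrder267Concrete.analyticOnNhd_Cmap`),
ON THE SINGLE-SCALE CUBE GEOMETRY `cubeGeometry L j S T` of the pair (fine bonds `S`, coarse bonds `T`) with the sup sizes of
the fine / coarse bonds, where the (73) majorant of the actual derivative of `Dfix` comes from the H-kernel letter `hHker`
through the kernel ↔ block-size dictionary (`hasMaj_fderiv_Dfix`), [3] (2.54) is the `ℓ¹` triangle inequality
(`triangle254_cubeGeometry`), (2.61) at the rate `⅛δ₀` is `rowSum_cubeGeometry` (constant `c₀(δ₀,⅛)ᵈ`), and `hN`/`hBloc` are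
the sharp-box letters `loc_le_norm_supSize`/`norm_le_loc_of_isLoc`; r12 gen 12's
`B11Ineq190DerivConcreteC.ineq190_and_hmv_covDerivBlockSize_concreteC_kernel` PRODUCES the same pair for the COVARIANT-DERIVATIVE
output size `covDerivBlockSize (cubeGeometry L j S T) y₀ Sc ξ U₀` (first-order compatibility letter `hev₁` in place of `hev`).
THIS FILE COMPOSES the two: p29's towers of [III] are INDEXED BY THE COARSE BONDS `T` (so the scheme's `B`-space IS `𝔸^T` and
the knit's input size IS the coarse sup size `supSize (cubeGeometry L j S T) boxT blkT`), the knit's own row sum [3] (2.61) at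
the rate `σ = αδ₀` (`σ + τ ≤ ⅛δ₀`, constant `c₀(δ₀,α)ᵈ`) is `rowSum_cubeGeometry`, its `hdist` is `dist_nonneg_cubeGeometry`,
and `0 ≤ const190 …` is bookkeeping (§0).  The [III] twin of `B15From190ConcreteC.ineq142_le_half_layer_concreteC` (§§1–3) and
`B15From190ConcreteC.ineq131_lt_layer_concreteC` (§4).

WHAT THIS FILE PROVES (kernel-checked, zero `sorry`; theorems only — no `def`, no new `Prop`, no named fact; axioms standard).
§0 (private) `const190_nonneg'`, `thetaD_nonneg` (the (73) weight `θ_𝔇` of the cube geometry is `≥ 0` under its smallness),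
   `c0_pow_nonneg`.
§1 `ineq319_lt_layer_concreteC` — **(3.19) `< δ_k`** at the concrete `C_K(U₁, ·)` (print: `𝐇_{k+1,□′}` is the function of the
   `(k+1)`-st operation, `K = k + 1` the top scale of p29's (3.17) tower), cube geometry at scale `K`, with `h190`, `hmv`,
   `hdist`, `hrow`, AND — inside r08's theorem — (73), (2.54), (2.61) at `⅛δ₀`, `hN`, `hBloc`, `hTm`/`hTm0` ALL DISCHARGED.
§2 `norm_bH322_le_layer_concreteC` — **p. 269, the bound on `𝐇^{(k)}`** (`‖𝐇^{(k)}(b)‖ ≤ 2·K₀·ε_k·e^{−R_k}`, print's O(1)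
   explicit) at the concrete `C_K(U₁, ·)`, same geometry, same discharges.
§3 `dev119_le_layer_concreteC` — **p. 250, `|U₁U_{1,□′}⁻¹ − 1| ≤ O(1)B₃e^{−δLM₂R₁}·44d²B₃ε₁`** (consumer level `k = 0`) at
   the concrete `C_K(U₁, ·)` (print: `K = 1`), same discharges.
§4 `ineq38_lt_layer_concreteC` — **(3.8) ⇒ "Thus χ_k(□) = 1" AT PRINT'S SCALE `η = L^{−k}`** at the concrete `C_k(U₁, ·)`
   (print: `𝐇_{k,□}` is the function of the `k`-th operation), cube geometry at scale `k`, BOTH output sizes (values on `□^∼`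
   AND the covariant derivatives `covDerivBlockSize … y₀ Sc L^{−k} U₀`): the sup pair from r08's theorem, the covariant pair
   from r12's `ineq190_and_hmv_covDerivBlockSize_concreteC_kernel`; same discharges.
HONEST SCOPE.  Assembly of landed theorems BY NAME (r11 `B14From190LayerSizes` p269225 ← `B14From190SupSize` p266115/p267982
← `B14Ineq38From190`/`B14Ineq319From190`/`B14Eq322From190`/`B14Eq119From190`; r08 `B11Ineq73HasMajConcrete` p309726 ←
`B11Ineq190ConcreteC` p305805 ← `B11Ineq190FromProp3`/`B11Prop3Concrete`; r12 `B11Ineq190DerivConcreteC` p312211; p06's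
concrete Sect. C files; p29's `B15LayerSupSize`/`B14ArgField36Lattice` towers).  MODEL-INSTANCE CHARACTER: [15]'s function
`𝓗(B)` of Prop. 9 belongs to the `k`-th renormalization transformation with its SEQUENCE of averaging operations and [3]'s
MULTI-SCALE geometry `{Λ_j}`, `d(y, y′)`; r08's concrete Sect. C datum is the SINGLE-SCALE remainder `C_j(U₁, ·)` of [4] on
`ℤᵈ` and `cubeGeometry L j S T` is ONE layer `Λ_j` (block distance `|y − y′|₁` in `Lʲ`-units, r08's honest scope); the
theorems here are therefore the single-scale concrete instances of gen 9's `B14From190SectG` theorems (which keep the scheme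
and the geometry abstract), not a construction of [III]'s `𝐇_{k,□}` / `𝐇_{k+1,□′}` / `𝐇^{(k)}` / `𝐇_{1,Ax}`.  The scale of the
instance is print's (the top scale `K` of the (3.17) tower for (3.19)/p. 269/p. 250, `k` for (3.7)/(3.8)); the background
`U₁` of `C_·` (regular in the sense of [4]: `pdev U₁ < α₁L^{−2k₁}` etc.) is kept DISTINCT from the towers' fine field `U₀`
and the (3.6) top field `V` (print: one configuration — instantiate `U₁ := U₀`).  What is LEFT as hypothesis in every
theorem here, exactly: (i) r08's located leaves of [15] Sect. G for the ABSTRACT data `G̃` (`hG190`), `Δ⁽²⁾H₀` (`hD2H0`),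
`H₀` (`hH0`), `H` (`hH`) as majorants between the cube sizes, (189) `h189` on the domain of (180) (author-omitted, G-B11-G2),
the smallness `q_G < 1` of (187) with the constant `c₀(δ₀,⅛)ᵈ`, the H-kernel letter `hHker` ([5] Thm 3.12 in kernel form)
with its smallness `hq`, the Sect. G `Regime 𝒢 0 W B₀ θ C₄ a₃ 𝔧 𝔞 ε₄`, `W`-analyticity on `‖Y‖ < a₃`, (46) `‖HX‖ ≤ B₀′‖X‖`,
the Prop. 3 smallness in tree units (`18·C₂(Lʲ)²·B₀′·d·c1h·ε₃ ≤ 1`, `2ε₃ ≤ b₁/2`, `ε₄ + 𝔞 ≤ ε₃`), the [4] regime of `U₁`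
(`hα₁…h155₁`), the argument field in the domain of (180) (`hB`); (ii) the (115)-presentation letter `hev` (for (3.8) also
`hev₁`) — real CLMs `ev x : 𝔸^S →L[ℝ] (Fin d → 𝔸)` reading off the values at the lattice point `x`, dominated on the output
box of `y` by the sup size of the fine bonds; (iii) the knits' own located side conditions verbatim (box/tower GEOMETRY
`hbox`/`hX`/`h15`/`hfar` — now in the cube distance —, `hgeom`, p29's lattice regularity data, (2.8)/(2.9) where used
(`hflow`, `hRR`), the explicit `A₁/A₀`- and smallness clauses, the weight `const190·c₀(δ₀,α)ᵈ ≤ B₃` of (190)'s explicit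
constant against print's `B₃`).  The words *«and finally Proposition 2 and (181)»* of [15] p. 308 (transport from the base
point, G-B11-G2a) remain untyped, as in `B11SectG`.  NOT summit progress.  r11 gen 95 (literature-prover-lit-balaban-r11-g95-0).
-/

noncomputable section

open scoped BigOperators NNReal
open NormedSpace Set

namespace Literature.MathematicalPhysics.QuantumFieldTheory.Balaban1983to89.B14From190ConcreteC

open Literature.MathematicalPhysics.QuantumFieldTheory.Balaban1983to89
open MatrixLog B7Prop1Explicit B7Prop2Explicit B7Prop1Local B7Prop3Flat B7Prop4Flat B7Eq92Concrete B7Eq162General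
  B8Lemma1NonAbelian B8Ineq129 B8Ineq130 B8Ineq165Descent B15Ineq184BlockAxial B15Ineq184Local B8Eq115GaugeFixing
  B14ArgField36Lattice B15LayerLocal B15LayerSupSize
open B7Prop3GeneralLinear B7Prop4GeneralLevels B7Prop5GeneralOperators B7Prop5GeneralInduction B7Prop5GeneralLevels
  B7Prop5General B7Ineq149Pairing B13Contraction113 B11Eq44Concrete B11Prop3Model
open B6RandomWalk B11SectG B11SupSize190 B11SeminormSize190 B11Eq174Chart B11Eq183Differentiation B11Presentation190
  B11Ineq190Actual B11Ineq190FromProp3 B11Ineq73HasMajConcrete B11Ineq190DerivConcreteC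
  B14Ineq38From190 B14Ineq319From190 B14Eq322From190 B14Eq119From190 B14From190SupSize B14From190LayerSizes

variable {d : ℕ}

/-! ## §0 Bookkeeping: the (190) constant is non-negative; the (73) weight `θ_𝔇` of the cube geometry is non-negative -/

/-- The (190) constant `const190 κ_B κ_N κ₃ B_G θ_W c_Δ A₀ A_H θ_𝔇 c` of `B11SectG` is `≥ 0` for non-negative data under the
smallness `q < 1` of (187) (as in `B14From190SectG`/`B15From190ConcreteC`, private there). [cite: Balaban1985Variational, (187)–(190) p.308] -/
private theorem const190_nonneg' {κB κN κ₃ BG θW cΔ A₀ AH θD c : ℝ} (hκB : 0 ≤ κB) (hκN : 0 ≤ κN) (hκ₃ : 0 ≤ κ₃)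
    (hc : 0 ≤ c) (hBG : 0 ≤ BG) (hθW : 0 ≤ θW) (hcΔ : 0 ≤ cΔ) (hA₀ : 0 ≤ A₀) (hAH : 0 ≤ AH) (hθD : 0 ≤ θD)
    (hq : qG κ₃ κN BG θW c < 1) : 0 ≤ const190 κB κN κ₃ BG θW cΔ A₀ AH θD c := by
  unfold const190
  have h₁ := constA0_nonneg (cΔ := cΔ) hκ₃ hκN hBG hθW hcΔ hA₀ hc hq
  positivity

/-- The (73) weight `θ_𝔇 = d·e^{½dδ₀}·(1 − q)⁻¹·e^{dδ₀}·C₃(Lʲ)²·2ε` of `B11Ineq73HasMajConcrete.hasMaj_fderiv_Dfix` is `≥ 0` under its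
smallness `q < 1`. [cite: Balaban1985Variational, (73) p.289] -/
private theorem thetaD_nonneg {L j : ℕ} {δ₀ ε B₁ : ℝ} (hε : 0 ≤ ε)
    (hq : (C3Gen d L * (((L : ℝ) ^ j) ^ 2 * (2 * ε)) * (2 * d) * B₁ * Real.exp (2 * d * δ₀)) * (d * B6.c0 δ₀ (1 / 2) ^ d) < 1) :
    (0 : ℝ) ≤ d * Real.exp (1 / 2 * d * δ₀) *
      ((1 - (C3Gen d L * (((L : ℝ) ^ j) ^ 2 * (2 * ε)) * (2 * d) * B₁ * Real.exp (2 * d * δ₀)) *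
          (d * B6.c0 δ₀ (1 / 2) ^ d))⁻¹ * (Real.exp (d * δ₀) * (C3Gen d L * ((L : ℝ) ^ j) ^ 2 * (2 * ε)))) := by
  have hC3 : 0 ≤ C3Gen d L := by unfold C3Gen C1ppGen; positivity
  have h1q : 0 < 1 - (C3Gen d L * (((L : ℝ) ^ j) ^ 2 * (2 * ε)) * (2 * d) * B₁ * Real.exp (2 * d * δ₀)) *
      (d * B6.c0 δ₀ (1 / 2) ^ d) := by linarith
  exact mul_nonneg (by positivity) (mul_nonneg (inv_nonneg.2 h1q.le) (by positivity))

/-- `0 ≤ c₀(δ₀, α)ᵈ` (the Lemma 2.1 [3] constant of the cube geometry). [cite: Balaban1984PropagatorsII, Lemma 2.1 (2.61) p.234] -/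
private theorem c0_pow_nonneg (δ₀ α : ℝ) (d : ℕ) : 0 ≤ B6.c0 δ₀ α ^ d :=
  pow_nonneg (tsum_nonneg fun _ => (Real.exp_pos _).le) d

/-! ## §1 (3.19) at the concrete `C_K`: p29's (3.17) tower field of `𝐇_{k+1,□′}` on the coarse bonds `T`, sup output size -/

section Ineq319C

variable {𝔸 : Type} [NormedRing 𝔸] [NormedAlgebra ℂ 𝔸] [CompleteSpace 𝔸] [NormOneClass 𝔸]

variable (L : ℕ) (hL : 2 ≤ L) {G : Subgroup 𝔸ˣ} (hAG : AvgClosed d L G) (k₁ : ℕ)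
  (U₁ : B7Prop1Explicit.Site d → Fin d → 𝔸ˣ) (hU₁ : ∀ x κ, U₁ x κ ∈ G) {α₁ : ℝ} (hα₁ : 0 < α₁)
  (hα₁3 : C0 d * α₁ ≤ 1 / 3) (hα₁4 : 4 * α₁ ≤ c2' d L) (h52₁ : pdev U₁ < α₁ * (((L : ℝ) ^ k₁)⁻¹) ^ 2)
  {b₁ : ℝ} (hb₁ : 0 < b₁)
  (hsmall₁ : Real.exp (4 * (800 * ((d : ℝ) + 1) ^ 2 * ((d : ℝ) + 4)) * α₁)
    * (1 + 8 * (131072 * ((d : ℝ) + 1) ^ 2) * ((L : ℝ) ^ k₁ * b₁)) ≤ 2)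
  (hc₃₁ : 4 * ((L : ℝ) ^ k₁ * b₁) < c3 d L)
  (h145₁ : 8 * d * thetaGen d L α₁ * (L : ℝ)⁻¹ ^ 4 ≤ 1)
  (h155₁ : (2 * (L : ℝ) - 1) * (L : ℝ)⁻¹ ^ 2 + 2 * d * thetaGen d L α₁ * (L : ℝ)⁻¹ ^ 3
    + 1 / 8 * (1 + 2 * d * thetaGen d L α₁ * (L : ℝ)⁻¹ ^ 2 + 2 * d * C3Gen d L * ((L : ℝ) ^ k₁ * b₁)) * (L : ℝ)⁻¹ ^ 2 ≤ 1)
  (S T : Finset (B7Prop1Explicit.Site d × Fin d))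

variable {𝒵 : Type} [NormedAddCommGroup 𝒵] [NormedSpace ℂ 𝒵] [CompleteSpace 𝒵]
  {𝒢 : 𝒵 →L[ℂ] (S → 𝔸)} {W : (S → 𝔸) → 𝒵} {D2 : (S → 𝔸) →L[ℂ] 𝒵} {H₀ : (T → 𝔸) →L[ℂ] (S → 𝔸)} {B₀ θ C₄ a₃ 𝔧 𝔞 ε₄ : ℝ}

include hL hAG hU₁ hα₁ hα₁3 hα₁4 h52₁ hb₁ hsmall₁ hc₃₁ h145₁ h155₁ in
/-- **(3.19) `< δ_k` ON THE LATTICE MODEL, AT THE CONCRETE `C_K(U₁, ·)` OF [4] ON THE SINGLE-SCALE CUBE GEOMETRY** — r11's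
`B14From190LayerSizes.ineq319_lt_of_ineq190_layer` (argument field `B :=` p29's (3.17) tower field
`i ↦ (1/i)log[M^{K−j}(U₀)(b_i)((Q^{s*}_jM^K(U₀))(b_i))⁻¹]` of `K` levels — *"the argument of the function 𝐇_{k+1,□′} is
bounded by 44d²B₃ε_{k+1}, and has a support in a boundary layer"* —, HERE INDEXED BY THE COARSE BONDS `T` of the scheme, so
that the scheme's `B`-space is `𝔸^T`; input size = the sup size of the coarse bonds of the cube geometry
`supSize (cubeGeometry L K S T) boxT blkT`; output size `supSize … box blk` — *"on □′^{∼2}"*; B-size and localisation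
discharged there) for the presented chart `𝐇 = x ↦ ev x (𝓗(B))`, `𝓗 = chartH179 𝒢 W D2 H₀ (· − H(Dfix(C_K(U₁,·)) ·)) ε₄` ([15]
(179) with the Sect. C selector `D = Dfix` = the solution of (49) for the concrete remainder `C_K(U₁, ·) =
B11Eq44Concrete.Cmap L U₁ S T K`), with the pair `h190`/`hmv` SUPPLIED BY NAME from r08 g11's
`B11Ineq73HasMajConcrete.ineq190_and_hmv_supSize_concreteC_kernel` — hence WITH (190) ITSELF, the mean-value reading, the (73)
majorant of the actual derivative of `Dfix` (from the H-kernel letter `hHker`), [3] (2.54) (`ℓ¹` triangle inequality of the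
cubes), Lemma 2.1 (2.61) at the rate `⅛δ₀` (constant `c₀(δ₀,⅛)ᵈ`) and the letters `hN`/`hBloc` ALL DISCHARGED; the knit's own
row sum [3] (2.61) at the rate `σ = αδ₀` (`σ + τ ≤ ⅛δ₀`) is `rowSum_cubeGeometry` (constant `c₀(δ₀,α)ᵈ`), its `hdist` is
`dist_nonneg_cubeGeometry`.  Remaining: the located leaves of [15] Sect. G for the ABSTRACT data `G̃`, `Δ⁽²⁾H₀`, `H₀`, `H` on
the cube sizes ((189) `h189`, kernel letters `hG190`/`hD2H0`/`hH0`/`hH`, `q_G < 1`), the H-kernel letter `hHker` with its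
smallness `hq`, the Sect. G `Regime`, `W`-analyticity, (46), the Prop. 3 smallness in tree units, the [4] regime of the
background `U₁` of `C_K` (kept distinct from the tower's fine field `U₀`: instantiate `U₁ := U₀` for print's single
configuration), the (115)-presentation letter `hev`, and the knit's side conditions verbatim (`δLM₂R_{k+1} ≤ τD`, (2.8)
`hflow`, (2.9) `hRR`, the regularity `2B₃ε_{k+1}(L^{−K})²` of `U₀` on the finest cube `h317`, `h15`, `hX`/`hfar`/`hbox`, the
`A₀/A₁`- and smallness clauses).
[cite: Balaban1988Convergent, (3.17)–(3.19) p.268, (2.8)–(2.9) p.256; Balaban1985Variational, Prop. 9 (190) pp.308–309, (179)–(180) p.306, (73) p.289, Prop. 3 p.289; Balaban1984PropagatorsII, Lemma 2.1 (2.61) p.234, (2.54) p.233] -/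
theorem ineq319_lt_layer_concreteC {K : ℕ} (hK : K ≤ k₁) (hd1 : 1 ≤ d)
    (Reg : Regime 𝒢 0 W B₀ θ C₄ a₃ 𝔧 𝔞 ε₄) (hWa : AnalyticOnNhd ℂ W {Y : S → 𝔸 | ‖Y‖ < a₃})
    (H : (T → 𝔸) →L[ℂ] (S → 𝔸)) {B₀' : ℝ} (hB₀' : 0 ≤ B₀') (hH46 : ∀ X, ‖H X‖ ≤ B₀' * ‖X‖)
    {c1h ε₃ : ℝ} (hc1h : 1 ≤ c1h) (hε₃ : 0 < ε₃)
    (h18 : 18 * ((8 * (131072 * ((d : ℝ) + 1) ^ 2) * Real.exp (4 * (800 * ((d : ℝ) + 1) ^ 2 * ((d : ℝ) + 4)) * α₁)) *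
      ((L : ℝ) ^ K) ^ 2) * B₀' * d * c1h * ε₃ ≤ 1) (h2 : 2 * ε₃ ≤ b₁ / 2) (hnest : ε₄ + 𝔞 ≤ ε₃)
    {δ₀ B₁ : ℝ} (hδ₀ : 0 < δ₀) (hB₁ : 0 ≤ B₁)
    (hHker : ∀ (c'' : T) (Y : 𝔸) (s : S),
      ‖H (Pi.single c'' Y) s‖ ≤ B₁ * Real.exp (-(δ₀ * ((B7Prop1Explicit.l1 (loK L K c''.1.1 - s.1.1) : ℝ) / (L : ℝ) ^ K))) * ‖Y‖)
    (hq : (C3Gen d L * (((L : ℝ) ^ K) ^ 2 * (2 * ε₃)) * (2 * d) * B₁ * Real.exp (2 * d * δ₀)) * (d * B6.c0 δ₀ (1 / 2) ^ d) < 1)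
    -- p29's (3.17) tower of `𝐇_{k+1,□′}` (fine field `U₀`, `K` levels), indexed by the coarse bonds `T`; its field in the domain of (180)
    (dep : T → ℕ) (pt : T → B7Prop1Explicit.Site d) (dir : T → Fin d)
    {U₀ : B7Prop1Explicit.Site d → Fin d → 𝔸ˣ} (hU₀ : ∀ x κ, U₀ x κ ∈ G)
    (hB : ‖H₀ (fun i => mlog (((avgIter L U₀ (K - dep i) (pt i) (dir i) *
          (pullIter L (avgIter L U₀ K) (dep i) (pt i) (dir i))⁻¹ : 𝔸ˣ) : 𝔸)))‖ < 𝔞 ∧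
      ‖D2 (H₀ (fun i => mlog (((avgIter L U₀ (K - dep i) (pt i) (dir i) *
          (pullIter L (avgIter L U₀ K) (dep i) (pt i) (dir i))⁻¹ : 𝔸ˣ) : 𝔸))))‖ < 𝔧)
    -- the output presentation on the cube geometry
    (box : (cubeGeometry L K S T).Site → Finset (B7Prop1Explicit.Site d))
    (blk : B7Prop1Explicit.Site d → (cubeGeometry L K S T).Site)
    (ev : B7Prop1Explicit.Site d → ((S → 𝔸) →L[ℝ] (Fin d → 𝔸))) {b3 : BlockNorm (cubeGeometry L K S T) 𝒵}
    (hev : ∀ (y : (cubeGeometry L K S T).Site) (v : S → 𝔸), ∀ x ∈ box y,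
      ‖ev x v‖ ≤ (supSize (cubeGeometry L K S T) (boxS L K S T) (blkS L K S T) :
        BlockNorm (cubeGeometry L K S T) (S → 𝔸)).loc y v)
    -- the located leaves of [15] Sect. G for the abstract data on the cube sizes
    {BG θW cΔ A₀ AH : ℝ} (hBG : 0 ≤ BG) (hθW : 0 ≤ θW) (hcΔ : 0 ≤ cΔ) (hA₀ : 0 ≤ A₀) (hAH : 0 ≤ AH)
    (hG190 : HasMaj b3 (supSize (cubeGeometry L K S T) (boxS L K S T) (blkS L K S T) :
        BlockNorm (cubeGeometry L K S T) (S → 𝔸))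
      (𝒢.restrictScalars ℝ : 𝒵 →ₗ[ℝ] (S → 𝔸)) (fun y y' => BG * Real.exp (-(δ₀ * (cubeGeometry L K S T).dist y y'))))
    (hD2H0 : HasMaj (supSize (cubeGeometry L K S T) (boxT L K S T) (blkT L K S T) :
        BlockNorm (cubeGeometry L K S T) (T → 𝔸)) b3
      ((D2 ∘L H₀).restrictScalars ℝ : (T → 𝔸) →ₗ[ℝ] 𝒵) (fun y y' => cΔ * Real.exp (-(δ₀ * (cubeGeometry L K S T).dist y y'))))
    (hH0 : HasMaj (supSize (cubeGeometry L K S T) (boxT L K S T) (blkT L K S T) :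
        BlockNorm (cubeGeometry L K S T) (T → 𝔸))
      (supSize (cubeGeometry L K S T) (boxS L K S T) (blkS L K S T) :
        BlockNorm (cubeGeometry L K S T) (S → 𝔸))
      (H₀.restrictScalars ℝ : (T → 𝔸) →ₗ[ℝ] (S → 𝔸)) (fun y y' => A₀ * Real.exp (-(δ₀ * (cubeGeometry L K S T).dist y y'))))
    (hH : HasMaj (supSize (cubeGeometry L K S T) (boxT L K S T) (blkT L K S T) :
        BlockNorm (cubeGeometry L K S T) (T → 𝔸))
      (supSize (cubeGeometry L K S T) (boxS L K S T) (blkS L K S T) :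
        BlockNorm (cubeGeometry L K S T) (S → 𝔸))
      (H.restrictScalars ℝ : (T → 𝔸) →ₗ[ℝ] (S → 𝔸)) (fun y y' => AH * Real.exp (-(δ₀ / 2 * (cubeGeometry L K S T).dist y y'))))
    (h189 : ∀ B' : T → 𝔸, ‖H₀ B'‖ < 𝔞 → ‖D2 (H₀ B')‖ < 𝔧 →
      Ineq189 (supSize (cubeGeometry L K S T) (boxS L K S T) (blkS L K S T) :
          BlockNorm (cubeGeometry L K S T) (S → 𝔸)) b3
        ((fderiv ℂ W (solA180 𝒢 W D2 H₀ ε₄ B' + H₀ B')).restrictScalars ℝ : (S → 𝔸) →ₗ[ℝ] 𝒵) θW δ₀)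
    (hqG : qG b3.κ 1 BG θW (B6.c0 δ₀ (1 / 8) ^ d) < 1)
    -- the [III] side: the letters of `B14From190LayerSizes.ineq319_lt_of_ineq190_layer` minus `h190`, `hmv`, `hdist`, `hrow`
    {α τ Dd : ℝ} (hσ : 0 < α) (hτ : 0 ≤ τ) (hστ : α * δ₀ + τ ≤ δ₀ / 8) (y : (cubeGeometry L K S T).Site)
    {B₃ δ M₂ R1 R β₀ A₀' A₁ ε εk1 δk : ℝ} (hB₃ : 0 < B₃) (hε1 : 0 < εk1)
    (hs3 : C0 d * (2 * B₃ * εk1) ≤ 1 / 3) (hs2 : 2 * (2 * B₃ * εk1) ≤ c2' d L)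
    (hs : 11 * (d : ℝ) ^ 2 * (2 * B₃ * εk1) ≤ 1 / 6) (lo hi : B7Prop1Explicit.Site d) (hlohi : lo ≤ hi)
    (h317 : pdevOn (tlo L lo K) (thi L hi K) U₀ < 2 * B₃ * εk1 * (((L : ℝ) ^ K)⁻¹) ^ 2)
    (h15 : ∀ n, n < K → ∀ z, tlo L lo n ≤ z → z ≤ thi L hi n → ∀ r : Fin d → Fin L,
      axialFn (avgIter L U₀ (K - (n + 1))) ((L : ℤ) • z) ((L : ℤ) • z + boxVec L r) = 1)
    (hX : ∀ i, dep i ≤ K ∧ tlo L lo (dep i) ≤ pt i ∧ pt i + e (dir i) ≤ thi L hi (dep i))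
    (hfar : ∀ y' i, i ∈ boxT L K S T y' → Dd ≤ (cubeGeometry L K S T).dist y y')
    {Hf : B7Prop1Explicit.Site d → Fin d → 𝔸}
    (hHf : Hf = fun x => ev x (chartH179 𝒢 W D2 H₀
      (fun Y : S → 𝔸 => Y - H (Dfix (B11Eq44Concrete.Cmap L U₁ S T K) (H : (T → 𝔸) →ₗ[ℂ] (S → 𝔸))
        ((8 * (131072 * ((d : ℝ) + 1) ^ 2) * Real.exp (4 * (800 * ((d : ℝ) + 1) ^ 2 * ((d : ℝ) + 4)) * α₁)) *
          ((L : ℝ) ^ K) ^ 2) Y)) ε₄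
      (fun i => mlog (((avgIter L U₀ (K - dep i) (pt i) (dir i) *
          (pullIter L (avgIter L U₀ K) (dep i) (pt i) (dir i))⁻¹ : 𝔸ˣ) : 𝔸)))))
    {k : ℕ} {α₀ : ℝ} (hα : 0 < α₀)
    (hα3 : C0 d * α₀ ≤ 1 / 3) (hα4 : 4 * α₀ ≤ c2' d L) (h52 : pdev U₀ < α₀ * (((L : ℝ) ^ k)⁻¹) ^ 2)
    (q : B7Prop1Explicit.Site d) (κ : Fin d)
    (hgeom : δ * L * M₂ * R1 ≤ τ * Dd)
    (hCB : const190 1 1 b3.κ BG θW cΔ A₀ AH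
        (d * Real.exp (1 / 2 * d * δ₀) *
          ((1 - (C3Gen d L * (((L : ℝ) ^ K) ^ 2 * (2 * ε₃)) * (2 * d) * B₁ * Real.exp (2 * d * δ₀)) *
              (d * B6.c0 δ₀ (1 / 2) ^ d))⁻¹ * (Real.exp (d * δ₀) * (C3Gen d L * ((L : ℝ) ^ K) ^ 2 * (2 * ε₃)))))
        (B6.c0 δ₀ (1 / 8) ^ d) * B6.c0 δ₀ α ^ d ≤ B₃)
    (hflow : εk1 ≤ (1 + β₀) * ε) (hRR : R ≤ δ * L * M₂ * R1)
    (hbox : ∀ y', B7Prop1Local.InBox (B7Prop1Local.loK L k q) (B7Prop1Local.bondHiK L k q κ) y' → y' ∈ box y)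
    (hβ₀ : 0 ≤ 1 + β₀) (hε : 0 ≤ ε) (hδk : 0 < δk) (hεδ : ε = A₀' / A₁ * δk)
    (hsmall : Real.exp (4 * (800 * ((d : ℝ) + 1) ^ 2 * ((d : ℝ) + 4)) * α₀)
      * (1 + 8 * (131072 * ((d : ℝ) + 1) ^ 2) * (44 * (d : ℝ) ^ 2 * B₃ ^ 2 * (1 + β₀) * Real.exp (-R) * ε)) ≤ 2)
    (hc₃ : 2 * (44 * (d : ℝ) ^ 2 * B₃ ^ 2 * (1 + β₀) * Real.exp (-R) * ε) ≤ c3 d L)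
    (hsm : 2048 * (d : ℝ) * (44 * (d : ℝ) ^ 2 * B₃ ^ 2 * (1 + β₀) * Real.exp (-R) * ε) ≤ 1)
    (h1 : 128 * (44 * (d : ℝ) ^ 2 * B₃ ^ 2 * (1 + β₀) * Real.exp (-R) * ε) ≤ 1)
    (hgk : (68 * ((d : ℝ) + 1) + 160 * d) * 44 * (d : ℝ) ^ 2 * B₃ ^ 2 * (1 + β₀) * (A₀' / A₁) * Real.exp (-R) < 1)
    (hL1 : 1 ≤ L) :
    ‖((avgIter L
          (gaugeAct (B7Eq84Concrete.glev L hL1 U₀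
              (expCfg (fun z μ => ((Complex.I : ℂ) * ((((L : ℝ) ^ (k + 1))⁻¹ : ℝ) : ℂ)) • Hf z μ)) k 0)⁻¹
            (expCfg (fun z μ => ((Complex.I : ℂ) * ((((L : ℝ) ^ (k + 1))⁻¹ : ℝ) : ℂ)) • Hf z μ) * U₀)) k q κ : 𝔸ˣ) : 𝔸)
        * (((avgIter L U₀ k q κ)⁻¹ : 𝔸ˣ) : 𝔸) - 1‖ < δk := by
  obtain ⟨h190, hmv⟩ := ineq190_and_hmv_supSize_concreteC_kernel L hL hAG k₁ U₁ hU₁ hα₁ hα₁3 hα₁4 h52₁ hb₁ hsmall₁ hc₃₁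
    h145₁ h155₁ S T hK hd1 Reg hWa H hB₀' hH46 hc1h hε₃ h18 h2 hnest hδ₀ hB₁ hHker hq hB ev hev hBG hθW hcΔ hA₀ hAH hG190
    hD2H0 hH0 hH h189 hqG
    (fun B' => fun x => ev x (chartH179 𝒢 W D2 H₀
      (fun Y : S → 𝔸 => Y - H (Dfix (B11Eq44Concrete.Cmap L U₁ S T K) (H : (T → 𝔸) →ₗ[ℂ] (S → 𝔸))
        ((8 * (131072 * ((d : ℝ) + 1) ^ 2) * Real.exp (4 * (800 * ((d : ℝ) + 1) ^ 2 * ((d : ℝ) + 4)) * α₁)) *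
          ((L : ℝ) ^ K) ^ 2) Y)) ε₄ B'))
    (fun t => (LinearMap.pi fun x => ((ev x : (S → 𝔸) →L[ℝ] (Fin d → 𝔸)) : (S → 𝔸) →ₗ[ℝ] (Fin d → 𝔸))) ∘ₗ
      ((fderiv ℂ (chartH179 𝒢 W D2 H₀
        (fun Y : S → 𝔸 => Y - H (Dfix (B11Eq44Concrete.Cmap L U₁ S T K) (H : (T → 𝔸) →ₗ[ℂ] (S → 𝔸))
          ((8 * (131072 * ((d : ℝ) + 1) ^ 2) * Real.exp (4 * (800 * ((d : ℝ) + 1) ^ 2 * ((d : ℝ) + 4)) * α₁)) *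
            ((L : ℝ) ^ K) ^ 2) Y)) ε₄)
        ((t : ℝ) • (fun i => mlog (((avgIter L U₀ (K - dep i) (pt i) (dir i) *
          (pullIter L (avgIter L U₀ K) (dep i) (pt i) (dir i))⁻¹ : 𝔸ˣ) : 𝔸))))).restrictScalars ℝ :
            (T → 𝔸) →ₗ[ℝ] (S → 𝔸)))
    (fun _ => rfl) (fun _ => rfl) y
  have hKc : 0 ≤ const190 1 1 b3.κ BG θW cΔ A₀ AH
      (d * Real.exp (1 / 2 * d * δ₀) *
        ((1 - (C3Gen d L * (((L : ℝ) ^ K) ^ 2 * (2 * ε₃)) * (2 * d) * B₁ * Real.exp (2 * d * δ₀)) *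
            (d * B6.c0 δ₀ (1 / 2) ^ d))⁻¹ * (Real.exp (d * δ₀) * (C3Gen d L * ((L : ℝ) ^ K) ^ 2 * (2 * ε₃)))))
      (B6.c0 δ₀ (1 / 8) ^ d) :=
    const190_nonneg' zero_le_one zero_le_one b3.κ_nonneg (c0_pow_nonneg δ₀ (1 / 8) d) hBG hθW hcΔ hA₀ hAH
      (thetaD_nonneg hε₃.le hq) hqG
  have hrow : RowSum (cubeGeometry L K S T) (α * δ₀) (B6.c0 δ₀ α ^ d) := rowSum_cubeGeometry L K S T (mul_pos hσ hδ₀)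
  subst hHf
  exact ineq319_lt_of_ineq190_layer (boxT L K S T) (blkT L K S T) dep pt dir box blk h190 hKc
    (dist_nonneg_cubeGeometry L K S T) hrow hτ hστ y hL hd1 hAG K hU₀ hB₃ hε1 hs3 hs2 hs lo hi hlohi h317 h15 hX hfar hmv
    hα hα3 hα4 h52 q κ hgeom hCB hflow hRR hbox hβ₀ hε hδk hεδ hsmall hc₃ hsm h1 hgk hL1

/-! ## §2 p. 269, the bound on `𝐇^{(k)}`, at the concrete `C_K`: the same (3.17)-type tower field on `T`, sup output size -/

include hL hAG hU₁ hα₁ hα₁3 hα₁4 h52₁ hb₁ hsmall₁ hc₃₁ h145₁ h155₁ in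
/-- **p. 269, the bound on `𝐇^{(k)}` (`‖𝐇^{(k)}(b)‖ ≤ 2·K₀·ε_k·e^{−R_k}`, `K₀ = (68(d+1)+160d)·44d²B₃²(1+β₀)`), ON THE LATTICE
MODEL, AT THE CONCRETE `C_K(U₁, ·)` OF [4] ON THE SINGLE-SCALE CUBE GEOMETRY** — r11's
`B14From190LayerSizes.norm_bH322_le_of_ineq190_layer` (the (3.17)-type tower field of `U₀ = U_{k+1,Λ^c_{k+1}∩Λ_k}` — *"We use
again the formula (3.17), but with U_{k+1,□′} replaced by the above function … with similar bounds"* — indexed by the coarse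
bonds `T`; input size `supSize (cubeGeometry L K S T) boxT blkT`, output size `supSize … box blk` — *"bounded on the set
S_{k+1}"*) for the presented chart at the concrete `C_K(U₁, ·)`, with `h190`/`hmv` SUPPLIED BY NAME from r08's
`B11Ineq73HasMajConcrete.ineq190_and_hmv_supSize_concreteC_kernel` ((190), mean value, (73), (2.54), (2.61) at `⅛δ₀`,
`hN`/`hBloc` DISCHARGED); the knit's row sum at the rate `σ = αδ₀` is `rowSum_cubeGeometry`, `hdist` is
`dist_nonneg_cubeGeometry`.  Remaining: as in §1, with the knit's side conditions verbatim (the domain clause `hsO` of the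
`log` series in place of the `< δ_k` clause `hgk`).
[cite: Balaban1988Convergent, (3.22) p.269, (3.17)–(3.18) p.268; Balaban1985Variational, Prop. 9 (190) pp.308–309, (179)–(180) p.306, (73) p.289, Prop. 3 p.289; Balaban1984PropagatorsII, Lemma 2.1 (2.61) p.234, (2.54) p.233] -/
theorem norm_bH322_le_layer_concreteC {K : ℕ} (hK : K ≤ k₁) (hd1 : 1 ≤ d)
    (Reg : Regime 𝒢 0 W B₀ θ C₄ a₃ 𝔧 𝔞 ε₄) (hWa : AnalyticOnNhd ℂ W {Y : S → 𝔸 | ‖Y‖ < a₃})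
    (H : (T → 𝔸) →L[ℂ] (S → 𝔸)) {B₀' : ℝ} (hB₀' : 0 ≤ B₀') (hH46 : ∀ X, ‖H X‖ ≤ B₀' * ‖X‖)
    {c1h ε₃ : ℝ} (hc1h : 1 ≤ c1h) (hε₃ : 0 < ε₃)
    (h18 : 18 * ((8 * (131072 * ((d : ℝ) + 1) ^ 2) * Real.exp (4 * (800 * ((d : ℝ) + 1) ^ 2 * ((d : ℝ) + 4)) * α₁)) *
      ((L : ℝ) ^ K) ^ 2) * B₀' * d * c1h * ε₃ ≤ 1) (h2 : 2 * ε₃ ≤ b₁ / 2) (hnest : ε₄ + 𝔞 ≤ ε₃)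
    {δ₀ B₁ : ℝ} (hδ₀ : 0 < δ₀) (hB₁ : 0 ≤ B₁)
    (hHker : ∀ (c'' : T) (Y : 𝔸) (s : S),
      ‖H (Pi.single c'' Y) s‖ ≤ B₁ * Real.exp (-(δ₀ * ((B7Prop1Explicit.l1 (loK L K c''.1.1 - s.1.1) : ℝ) / (L : ℝ) ^ K))) * ‖Y‖)
    (hq : (C3Gen d L * (((L : ℝ) ^ K) ^ 2 * (2 * ε₃)) * (2 * d) * B₁ * Real.exp (2 * d * δ₀)) * (d * B6.c0 δ₀ (1 / 2) ^ d) < 1)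
    (dep : T → ℕ) (pt : T → B7Prop1Explicit.Site d) (dir : T → Fin d)
    {U₀ : B7Prop1Explicit.Site d → Fin d → 𝔸ˣ} (hU₀ : ∀ x κ, U₀ x κ ∈ G)
    (hB : ‖H₀ (fun i => mlog (((avgIter L U₀ (K - dep i) (pt i) (dir i) *
          (pullIter L (avgIter L U₀ K) (dep i) (pt i) (dir i))⁻¹ : 𝔸ˣ) : 𝔸)))‖ < 𝔞 ∧
      ‖D2 (H₀ (fun i => mlog (((avgIter L U₀ (K - dep i) (pt i) (dir i) *
          (pullIter L (avgIter L U₀ K) (dep i) (pt i) (dir i))⁻¹ : 𝔸ˣ) : 𝔸))))‖ < 𝔧)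
    (box : (cubeGeometry L K S T).Site → Finset (B7Prop1Explicit.Site d))
    (blk : B7Prop1Explicit.Site d → (cubeGeometry L K S T).Site)
    (ev : B7Prop1Explicit.Site d → ((S → 𝔸) →L[ℝ] (Fin d → 𝔸))) {b3 : BlockNorm (cubeGeometry L K S T) 𝒵}
    (hev : ∀ (y : (cubeGeometry L K S T).Site) (v : S → 𝔸), ∀ x ∈ box y,
      ‖ev x v‖ ≤ (supSize (cubeGeometry L K S T) (boxS L K S T) (blkS L K S T) :
        BlockNorm (cubeGeometry L K S T) (S → 𝔸)).loc y v)
    {BG θW cΔ A₀ AH : ℝ} (hBG : 0 ≤ BG) (hθW : 0 ≤ θW) (hcΔ : 0 ≤ cΔ) (hA₀ : 0 ≤ A₀) (hAH : 0 ≤ AH)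
    (hG190 : HasMaj b3 (supSize (cubeGeometry L K S T) (boxS L K S T) (blkS L K S T) :
        BlockNorm (cubeGeometry L K S T) (S → 𝔸))
      (𝒢.restrictScalars ℝ : 𝒵 →ₗ[ℝ] (S → 𝔸)) (fun y y' => BG * Real.exp (-(δ₀ * (cubeGeometry L K S T).dist y y'))))
    (hD2H0 : HasMaj (supSize (cubeGeometry L K S T) (boxT L K S T) (blkT L K S T) :
        BlockNorm (cubeGeometry L K S T) (T → 𝔸)) b3
      ((D2 ∘L H₀).restrictScalars ℝ : (T → 𝔸) →ₗ[ℝ] 𝒵) (fun y y' => cΔ * Real.exp (-(δ₀ * (cubeGeometry L K S T).dist y y'))))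
    (hH0 : HasMaj (supSize (cubeGeometry L K S T) (boxT L K S T) (blkT L K S T) :
        BlockNorm (cubeGeometry L K S T) (T → 𝔸))
      (supSize (cubeGeometry L K S T) (boxS L K S T) (blkS L K S T) :
        BlockNorm (cubeGeometry L K S T) (S → 𝔸))
      (H₀.restrictScalars ℝ : (T → 𝔸) →ₗ[ℝ] (S → 𝔸)) (fun y y' => A₀ * Real.exp (-(δ₀ * (cubeGeometry L K S T).dist y y'))))
    (hH : HasMaj (supSize (cubeGeometry L K S T) (boxT L K S T) (blkT L K S T) :
        BlockNorm (cubeGeometry L K S T) (T → 𝔸))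
      (supSize (cubeGeometry L K S T) (boxS L K S T) (blkS L K S T) :
        BlockNorm (cubeGeometry L K S T) (S → 𝔸))
      (H.restrictScalars ℝ : (T → 𝔸) →ₗ[ℝ] (S → 𝔸)) (fun y y' => AH * Real.exp (-(δ₀ / 2 * (cubeGeometry L K S T).dist y y'))))
    (h189 : ∀ B' : T → 𝔸, ‖H₀ B'‖ < 𝔞 → ‖D2 (H₀ B')‖ < 𝔧 →
      Ineq189 (supSize (cubeGeometry L K S T) (boxS L K S T) (blkS L K S T) :
          BlockNorm (cubeGeometry L K S T) (S → 𝔸)) b3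
        ((fderiv ℂ W (solA180 𝒢 W D2 H₀ ε₄ B' + H₀ B')).restrictScalars ℝ : (S → 𝔸) →ₗ[ℝ] 𝒵) θW δ₀)
    (hqG : qG b3.κ 1 BG θW (B6.c0 δ₀ (1 / 8) ^ d) < 1)
    -- the [III] side: the letters of `B14From190LayerSizes.norm_bH322_le_of_ineq190_layer` minus `h190`, `hmv`, `hdist`, `hrow`
    {α τ Dd : ℝ} (hσ : 0 < α) (hτ : 0 ≤ τ) (hστ : α * δ₀ + τ ≤ δ₀ / 8) (y : (cubeGeometry L K S T).Site)
    {B₃ δ M₂ R1 R β₀ ε εk1 : ℝ} (hB₃ : 0 < B₃) (hε1 : 0 < εk1)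
    (hs3 : C0 d * (2 * B₃ * εk1) ≤ 1 / 3) (hs2 : 2 * (2 * B₃ * εk1) ≤ c2' d L)
    (hs : 11 * (d : ℝ) ^ 2 * (2 * B₃ * εk1) ≤ 1 / 6) (lo hi : B7Prop1Explicit.Site d) (hlohi : lo ≤ hi)
    (h317 : pdevOn (tlo L lo K) (thi L hi K) U₀ < 2 * B₃ * εk1 * (((L : ℝ) ^ K)⁻¹) ^ 2)
    (h15 : ∀ n, n < K → ∀ z, tlo L lo n ≤ z → z ≤ thi L hi n → ∀ r : Fin d → Fin L,
      axialFn (avgIter L U₀ (K - (n + 1))) ((L : ℤ) • z) ((L : ℤ) • z + boxVec L r) = 1)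
    (hX : ∀ i, dep i ≤ K ∧ tlo L lo (dep i) ≤ pt i ∧ pt i + e (dir i) ≤ thi L hi (dep i))
    (hfar : ∀ y' i, i ∈ boxT L K S T y' → Dd ≤ (cubeGeometry L K S T).dist y y')
    {Hf : B7Prop1Explicit.Site d → Fin d → 𝔸}
    (hHf : Hf = fun x => ev x (chartH179 𝒢 W D2 H₀
      (fun Y : S → 𝔸 => Y - H (Dfix (B11Eq44Concrete.Cmap L U₁ S T K) (H : (T → 𝔸) →ₗ[ℂ] (S → 𝔸))
        ((8 * (131072 * ((d : ℝ) + 1) ^ 2) * Real.exp (4 * (800 * ((d : ℝ) + 1) ^ 2 * ((d : ℝ) + 4)) * α₁)) *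
          ((L : ℝ) ^ K) ^ 2) Y)) ε₄
      (fun i => mlog (((avgIter L U₀ (K - dep i) (pt i) (dir i) *
          (pullIter L (avgIter L U₀ K) (dep i) (pt i) (dir i))⁻¹ : 𝔸ˣ) : 𝔸)))))
    {k : ℕ} {α₀ : ℝ} (hα : 0 < α₀)
    (hα3 : C0 d * α₀ ≤ 1 / 3) (hα4 : 4 * α₀ ≤ c2' d L) (h52 : pdev U₀ < α₀ * (((L : ℝ) ^ k)⁻¹) ^ 2)
    (q : B7Prop1Explicit.Site d) (κ : Fin d)
    (hgeom : δ * L * M₂ * R1 ≤ τ * Dd)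
    (hCB : const190 1 1 b3.κ BG θW cΔ A₀ AH
        (d * Real.exp (1 / 2 * d * δ₀) *
          ((1 - (C3Gen d L * (((L : ℝ) ^ K) ^ 2 * (2 * ε₃)) * (2 * d) * B₁ * Real.exp (2 * d * δ₀)) *
              (d * B6.c0 δ₀ (1 / 2) ^ d))⁻¹ * (Real.exp (d * δ₀) * (C3Gen d L * ((L : ℝ) ^ K) ^ 2 * (2 * ε₃)))))
        (B6.c0 δ₀ (1 / 8) ^ d) * B6.c0 δ₀ α ^ d ≤ B₃)
    (hflow : εk1 ≤ (1 + β₀) * ε) (hRR : R ≤ δ * L * M₂ * R1)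
    (hbox : ∀ y', B7Prop1Local.InBox (B7Prop1Local.loK L k q) (B7Prop1Local.bondHiK L k q κ) y' → y' ∈ box y)
    (hβ₀ : 0 ≤ 1 + β₀) (hε : 0 ≤ ε)
    (hsmall : Real.exp (4 * (800 * ((d : ℝ) + 1) ^ 2 * ((d : ℝ) + 4)) * α₀)
      * (1 + 8 * (131072 * ((d : ℝ) + 1) ^ 2) * (44 * (d : ℝ) ^ 2 * B₃ ^ 2 * (1 + β₀) * Real.exp (-R) * ε)) ≤ 2)
    (hc₃ : 2 * (44 * (d : ℝ) ^ 2 * B₃ ^ 2 * (1 + β₀) * Real.exp (-R) * ε) ≤ c3 d L)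
    (hsm : 2048 * (d : ℝ) * (44 * (d : ℝ) ^ 2 * B₃ ^ 2 * (1 + β₀) * Real.exp (-R) * ε) ≤ 1)
    (h1 : 128 * (44 * (d : ℝ) ^ 2 * B₃ ^ 2 * (1 + β₀) * Real.exp (-R) * ε) ≤ 1) (hL1 : 1 ≤ L)
    (hsO : (68 * ((d : ℝ) + 1) + 160 * d) * 44 * (d : ℝ) ^ 2 * B₃ ^ 2 * (1 + β₀) * ε * Real.exp (-R) ≤ 1 / 2) :
    ‖B14.Eq316.bH (avgIter L
          (gaugeAct (B7Eq84Concrete.glev L hL1 U₀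
              (expCfg (fun z μ => ((Complex.I : ℂ) * ((((L : ℝ) ^ (k + 1))⁻¹ : ℝ) : ℂ)) • Hf z μ)) k 0)⁻¹
            (expCfg (fun z μ => ((Complex.I : ℂ) * ((((L : ℝ) ^ (k + 1))⁻¹ : ℝ) : ℂ)) • Hf z μ) * U₀)) k q κ)
        (avgIter L U₀ k q κ)‖
      ≤ 2 * ((68 * ((d : ℝ) + 1) + 160 * d) * 44 * (d : ℝ) ^ 2 * B₃ ^ 2 * (1 + β₀)) * ε * Real.exp (-R) := by
  obtain ⟨h190, hmv⟩ := ineq190_and_hmv_supSize_concreteC_kernel L hL hAG k₁ U₁ hU₁ hα₁ hα₁3 hα₁4 h52₁ hb₁ hsmall₁ hc₃₁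
    h145₁ h155₁ S T hK hd1 Reg hWa H hB₀' hH46 hc1h hε₃ h18 h2 hnest hδ₀ hB₁ hHker hq hB ev hev hBG hθW hcΔ hA₀ hAH hG190
    hD2H0 hH0 hH h189 hqG
    (fun B' => fun x => ev x (chartH179 𝒢 W D2 H₀
      (fun Y : S → 𝔸 => Y - H (Dfix (B11Eq44Concrete.Cmap L U₁ S T K) (H : (T → 𝔸) →ₗ[ℂ] (S → 𝔸))
        ((8 * (131072 * ((d : ℝ) + 1) ^ 2) * Real.exp (4 * (800 * ((d : ℝ) + 1) ^ 2 * ((d : ℝ) + 4)) * α₁)) *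
          ((L : ℝ) ^ K) ^ 2) Y)) ε₄ B'))
    (fun t => (LinearMap.pi fun x => ((ev x : (S → 𝔸) →L[ℝ] (Fin d → 𝔸)) : (S → 𝔸) →ₗ[ℝ] (Fin d → 𝔸))) ∘ₗ
      ((fderiv ℂ (chartH179 𝒢 W D2 H₀
        (fun Y : S → 𝔸 => Y - H (Dfix (B11Eq44Concrete.Cmap L U₁ S T K) (H : (T → 𝔸) →ₗ[ℂ] (S → 𝔸))
          ((8 * (131072 * ((d : ℝ) + 1) ^ 2) * Real.exp (4 * (800 * ((d : ℝ) + 1) ^ 2 * ((d : ℝ) + 4)) * α₁)) *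
            ((L : ℝ) ^ K) ^ 2) Y)) ε₄)
        ((t : ℝ) • (fun i => mlog (((avgIter L U₀ (K - dep i) (pt i) (dir i) *
          (pullIter L (avgIter L U₀ K) (dep i) (pt i) (dir i))⁻¹ : 𝔸ˣ) : 𝔸))))).restrictScalars ℝ :
            (T → 𝔸) →ₗ[ℝ] (S → 𝔸)))
    (fun _ => rfl) (fun _ => rfl) y
  have hKc : 0 ≤ const190 1 1 b3.κ BG θW cΔ A₀ AH
      (d * Real.exp (1 / 2 * d * δ₀) *
        ((1 - (C3Gen d L * (((L : ℝ) ^ K) ^ 2 * (2 * ε₃)) * (2 * d) * B₁ * Real.exp (2 * d * δ₀)) *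
            (d * B6.c0 δ₀ (1 / 2) ^ d))⁻¹ * (Real.exp (d * δ₀) * (C3Gen d L * ((L : ℝ) ^ K) ^ 2 * (2 * ε₃)))))
      (B6.c0 δ₀ (1 / 8) ^ d) :=
    const190_nonneg' zero_le_one zero_le_one b3.κ_nonneg (c0_pow_nonneg δ₀ (1 / 8) d) hBG hθW hcΔ hA₀ hAH
      (thetaD_nonneg hε₃.le hq) hqG
  have hrow : RowSum (cubeGeometry L K S T) (α * δ₀) (B6.c0 δ₀ α ^ d) := rowSum_cubeGeometry L K S T (mul_pos hσ hδ₀)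
  subst hHf
  exact norm_bH322_le_of_ineq190_layer (boxT L K S T) (blkT L K S T) dep pt dir box blk h190 hKc
    (dist_nonneg_cubeGeometry L K S T) hrow hτ hστ y hL hd1 hAG K hU₀ hB₃ hε1 hs3 hs2 hs lo hi hlohi h317 h15 hX hfar hmv
    hα hα3 hα4 h52 q κ hgeom hCB hflow hRR hbox hβ₀ hε hsmall hc₃ hsm h1 hL1 hsO

/-! ## §3 p. 250, `|U₁U_{1,□′}⁻¹ − 1|`, at the concrete `C_K`: the (1.18)/(3.17)-type tower field on `T`, consumer level `k = 0` -/

include hL hAG hU₁ hα₁ hα₁3 hα₁4 h52₁ hb₁ hsmall₁ hc₃₁ h145₁ h155₁ in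
/-- **p. 250, `|U₁U_{1,□′}⁻¹ − 1| ≤ O(1)B₃e^{−δLM₂R₁}·44d²B₃ε₁` with print's O(1) explicit (`68(d+1)+160d`), ON THE LATTICE
MODEL, AT THE CONCRETE `C_K(U₁, ·)` OF [4] ON THE SINGLE-SCALE CUBE GEOMETRY** — r11's
`B14From190LayerSizes.dev119_le_of_ineq190_layer` (consumer level `k = 0`, *"no averaging"*; the (1.18)/(3.17)-type tower
field of `U₀ = U_{1,□′}` on `K` levels — print: `K = 1` —, indexed by the coarse bonds `T`; input size
`supSize (cubeGeometry L K S T) boxT blkT`, output size `supSize … box blk` — *"on □′^{∼2}"*) for the presented chart at the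
concrete `C_K(U₁, ·)`, with `h190`/`hmv` SUPPLIED BY NAME from r08's
`B11Ineq73HasMajConcrete.ineq190_and_hmv_supSize_concreteC_kernel` ((190), mean value, (73), (2.54), (2.61) at `⅛δ₀`,
`hN`/`hBloc` DISCHARGED); the knit's row sum at the rate `σ = αδ₀` is `rowSum_cubeGeometry`, `hdist` is
`dist_nonneg_cubeGeometry`.  Remaining: as in §1, with the knit's side conditions verbatim (`δLM₂R₁ ≤ τD`, the regularity
`2B₃ε₁(L^{−K})²` of `U₀` on the finest cube, the `ε₁`-smallness clauses; *"if M₂R₁ is large enough"*).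
[cite: Balaban1988Convergent, (1.18)–(1.19) p.250, (3.17) p.268; Balaban1985Variational, Prop. 9 (190) pp.308–309, (179)–(180) p.306, (73) p.289, Prop. 3 p.289; Balaban1984PropagatorsII, Lemma 2.1 (2.61) p.234, (2.54) p.233] -/
theorem dev119_le_layer_concreteC {K : ℕ} (hK : K ≤ k₁) (hd1 : 1 ≤ d)
    (Reg : Regime 𝒢 0 W B₀ θ C₄ a₃ 𝔧 𝔞 ε₄) (hWa : AnalyticOnNhd ℂ W {Y : S → 𝔸 | ‖Y‖ < a₃})
    (H : (T → 𝔸) →L[ℂ] (S → 𝔸)) {B₀' : ℝ} (hB₀' : 0 ≤ B₀') (hH46 : ∀ X, ‖H X‖ ≤ B₀' * ‖X‖)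
    {c1h ε₃ : ℝ} (hc1h : 1 ≤ c1h) (hε₃ : 0 < ε₃)
    (h18 : 18 * ((8 * (131072 * ((d : ℝ) + 1) ^ 2) * Real.exp (4 * (800 * ((d : ℝ) + 1) ^ 2 * ((d : ℝ) + 4)) * α₁)) *
      ((L : ℝ) ^ K) ^ 2) * B₀' * d * c1h * ε₃ ≤ 1) (h2 : 2 * ε₃ ≤ b₁ / 2) (hnest : ε₄ + 𝔞 ≤ ε₃)
    {δ₀ B₁ : ℝ} (hδ₀ : 0 < δ₀) (hB₁ : 0 ≤ B₁)
    (hHker : ∀ (c'' : T) (Y : 𝔸) (s : S),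
      ‖H (Pi.single c'' Y) s‖ ≤ B₁ * Real.exp (-(δ₀ * ((B7Prop1Explicit.l1 (loK L K c''.1.1 - s.1.1) : ℝ) / (L : ℝ) ^ K))) * ‖Y‖)
    (hq : (C3Gen d L * (((L : ℝ) ^ K) ^ 2 * (2 * ε₃)) * (2 * d) * B₁ * Real.exp (2 * d * δ₀)) * (d * B6.c0 δ₀ (1 / 2) ^ d) < 1)
    (dep : T → ℕ) (pt : T → B7Prop1Explicit.Site d) (dir : T → Fin d)
    {U₀ : B7Prop1Explicit.Site d → Fin d → 𝔸ˣ} (hU₀ : ∀ x κ, U₀ x κ ∈ G)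
    (hB : ‖H₀ (fun i => mlog (((avgIter L U₀ (K - dep i) (pt i) (dir i) *
          (pullIter L (avgIter L U₀ K) (dep i) (pt i) (dir i))⁻¹ : 𝔸ˣ) : 𝔸)))‖ < 𝔞 ∧
      ‖D2 (H₀ (fun i => mlog (((avgIter L U₀ (K - dep i) (pt i) (dir i) *
          (pullIter L (avgIter L U₀ K) (dep i) (pt i) (dir i))⁻¹ : 𝔸ˣ) : 𝔸))))‖ < 𝔧)
    (box : (cubeGeometry L K S T).Site → Finset (B7Prop1Explicit.Site d))
    (blk : B7Prop1Explicit.Site d → (cubeGeometry L K S T).Site)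
    (ev : B7Prop1Explicit.Site d → ((S → 𝔸) →L[ℝ] (Fin d → 𝔸))) {b3 : BlockNorm (cubeGeometry L K S T) 𝒵}
    (hev : ∀ (y : (cubeGeometry L K S T).Site) (v : S → 𝔸), ∀ x ∈ box y,
      ‖ev x v‖ ≤ (supSize (cubeGeometry L K S T) (boxS L K S T) (blkS L K S T) :
        BlockNorm (cubeGeometry L K S T) (S → 𝔸)).loc y v)
    {BG θW cΔ A₀ AH : ℝ} (hBG : 0 ≤ BG) (hθW : 0 ≤ θW) (hcΔ : 0 ≤ cΔ) (hA₀ : 0 ≤ A₀) (hAH : 0 ≤ AH)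
    (hG190 : HasMaj b3 (supSize (cubeGeometry L K S T) (boxS L K S T) (blkS L K S T) :
        BlockNorm (cubeGeometry L K S T) (S → 𝔸))
      (𝒢.restrictScalars ℝ : 𝒵 →ₗ[ℝ] (S → 𝔸)) (fun y y' => BG * Real.exp (-(δ₀ * (cubeGeometry L K S T).dist y y'))))
    (hD2H0 : HasMaj (supSize (cubeGeometry L K S T) (boxT L K S T) (blkT L K S T) :
        BlockNorm (cubeGeometry L K S T) (T → 𝔸)) b3
      ((D2 ∘L H₀).restrictScalars ℝ : (T → 𝔸) →ₗ[ℝ] 𝒵) (fun y y' => cΔ * Real.exp (-(δ₀ * (cubeGeometry L K S T).dist y y'))))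
    (hH0 : HasMaj (supSize (cubeGeometry L K S T) (boxT L K S T) (blkT L K S T) :
        BlockNorm (cubeGeometry L K S T) (T → 𝔸))
      (supSize (cubeGeometry L K S T) (boxS L K S T) (blkS L K S T) :
        BlockNorm (cubeGeometry L K S T) (S → 𝔸))
      (H₀.restrictScalars ℝ : (T → 𝔸) →ₗ[ℝ] (S → 𝔸)) (fun y y' => A₀ * Real.exp (-(δ₀ * (cubeGeometry L K S T).dist y y'))))
    (hH : HasMaj (supSize (cubeGeometry L K S T) (boxT L K S T) (blkT L K S T) :
        BlockNorm (cubeGeometry L K S T) (T → 𝔸))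
      (supSize (cubeGeometry L K S T) (boxS L K S T) (blkS L K S T) :
        BlockNorm (cubeGeometry L K S T) (S → 𝔸))
      (H.restrictScalars ℝ : (T → 𝔸) →ₗ[ℝ] (S → 𝔸)) (fun y y' => AH * Real.exp (-(δ₀ / 2 * (cubeGeometry L K S T).dist y y'))))
    (h189 : ∀ B' : T → 𝔸, ‖H₀ B'‖ < 𝔞 → ‖D2 (H₀ B')‖ < 𝔧 →
      Ineq189 (supSize (cubeGeometry L K S T) (boxS L K S T) (blkS L K S T) :
          BlockNorm (cubeGeometry L K S T) (S → 𝔸)) b3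
        ((fderiv ℂ W (solA180 𝒢 W D2 H₀ ε₄ B' + H₀ B')).restrictScalars ℝ : (S → 𝔸) →ₗ[ℝ] 𝒵) θW δ₀)
    (hqG : qG b3.κ 1 BG θW (B6.c0 δ₀ (1 / 8) ^ d) < 1)
    -- the [III] side: the letters of `B14From190LayerSizes.dev119_le_of_ineq190_layer` minus `h190`, `hmv`, `hdist`, `hrow`
    {α τ Dd : ℝ} (hσ : 0 < α) (hτ : 0 ≤ τ) (hστ : α * δ₀ + τ ≤ δ₀ / 8) (y : (cubeGeometry L K S T).Site)
    {B₃ δ M₂ R₁ ε₁ : ℝ} (hB₃ : 0 < B₃) (hε1 : 0 < ε₁)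
    (hs3 : C0 d * (2 * B₃ * ε₁) ≤ 1 / 3) (hs2 : 2 * (2 * B₃ * ε₁) ≤ c2' d L)
    (hs : 11 * (d : ℝ) ^ 2 * (2 * B₃ * ε₁) ≤ 1 / 6) (lo hi : B7Prop1Explicit.Site d) (hlohi : lo ≤ hi)
    (h317 : pdevOn (tlo L lo K) (thi L hi K) U₀ < 2 * B₃ * ε₁ * (((L : ℝ) ^ K)⁻¹) ^ 2)
    (h15 : ∀ n, n < K → ∀ z, tlo L lo n ≤ z → z ≤ thi L hi n → ∀ r : Fin d → Fin L,
      axialFn (avgIter L U₀ (K - (n + 1))) ((L : ℤ) • z) ((L : ℤ) • z + boxVec L r) = 1)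
    (hX : ∀ i, dep i ≤ K ∧ tlo L lo (dep i) ≤ pt i ∧ pt i + e (dir i) ≤ thi L hi (dep i))
    (hfar : ∀ y' i, i ∈ boxT L K S T y' → Dd ≤ (cubeGeometry L K S T).dist y y')
    {Hf : B7Prop1Explicit.Site d → Fin d → 𝔸}
    (hHf : Hf = fun x => ev x (chartH179 𝒢 W D2 H₀
      (fun Y : S → 𝔸 => Y - H (Dfix (B11Eq44Concrete.Cmap L U₁ S T K) (H : (T → 𝔸) →ₗ[ℂ] (S → 𝔸))
        ((8 * (131072 * ((d : ℝ) + 1) ^ 2) * Real.exp (4 * (800 * ((d : ℝ) + 1) ^ 2 * ((d : ℝ) + 4)) * α₁)) *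
          ((L : ℝ) ^ K) ^ 2) Y)) ε₄
      (fun i => mlog (((avgIter L U₀ (K - dep i) (pt i) (dir i) *
          (pullIter L (avgIter L U₀ K) (dep i) (pt i) (dir i))⁻¹ : 𝔸ˣ) : 𝔸)))))
    {α₀ : ℝ} (hα : 0 < α₀)
    (hα3 : C0 d * α₀ ≤ 1 / 3) (hα4 : 4 * α₀ ≤ c2' d L) (h52 : pdev U₀ < α₀ * (((L : ℝ) ^ 0)⁻¹) ^ 2)
    (q : B7Prop1Explicit.Site d) (κ : Fin d)
    (hgeom : δ * L * M₂ * R₁ ≤ τ * Dd)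
    (hCB : const190 1 1 b3.κ BG θW cΔ A₀ AH
        (d * Real.exp (1 / 2 * d * δ₀) *
          ((1 - (C3Gen d L * (((L : ℝ) ^ K) ^ 2 * (2 * ε₃)) * (2 * d) * B₁ * Real.exp (2 * d * δ₀)) *
              (d * B6.c0 δ₀ (1 / 2) ^ d))⁻¹ * (Real.exp (d * δ₀) * (C3Gen d L * ((L : ℝ) ^ K) ^ 2 * (2 * ε₃)))))
        (B6.c0 δ₀ (1 / 8) ^ d) * B6.c0 δ₀ α ^ d ≤ B₃)
    (hbox : ∀ y', B7Prop1Local.InBox (B7Prop1Local.loK L 0 q) (B7Prop1Local.bondHiK L 0 q κ) y' → y' ∈ box y)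
    (hsmall : Real.exp (4 * (800 * ((d : ℝ) + 1) ^ 2 * ((d : ℝ) + 4)) * α₀)
      * (1 + 8 * (131072 * ((d : ℝ) + 1) ^ 2) * (B₃ * Real.exp (-(δ * L * M₂ * R₁)) * (44 * (d : ℝ) ^ 2 * B₃) * ε₁)) ≤ 2)
    (hc₃ : 2 * (B₃ * Real.exp (-(δ * L * M₂ * R₁)) * (44 * (d : ℝ) ^ 2 * B₃) * ε₁) ≤ c3 d L)
    (hsm : 2048 * (d : ℝ) * (B₃ * Real.exp (-(δ * L * M₂ * R₁)) * (44 * (d : ℝ) ^ 2 * B₃) * ε₁) ≤ 1)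
    (h1 : 128 * (B₃ * Real.exp (-(δ * L * M₂ * R₁)) * (44 * (d : ℝ) ^ 2 * B₃) * ε₁) ≤ 1) (hL1 : 1 ≤ L) :
    ‖((avgIter L
          (gaugeAct (B7Eq84Concrete.glev L hL1 U₀
              (expCfg (fun z μ => ((Complex.I : ℂ) * ((((L : ℝ) ^ (0 + 1))⁻¹ : ℝ) : ℂ)) • Hf z μ)) 0 0)⁻¹
            (expCfg (fun z μ => ((Complex.I : ℂ) * ((((L : ℝ) ^ (0 + 1))⁻¹ : ℝ) : ℂ)) • Hf z μ) * U₀)) 0 q κ : 𝔸ˣ) : 𝔸)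
        * (((avgIter L U₀ 0 q κ)⁻¹ : 𝔸ˣ) : 𝔸) - 1‖
      ≤ (68 * ((d : ℝ) + 1) + 160 * d) * (B₃ * Real.exp (-(δ * L * M₂ * R₁)) * (44 * (d : ℝ) ^ 2 * B₃) * ε₁) := by
  obtain ⟨h190, hmv⟩ := ineq190_and_hmv_supSize_concreteC_kernel L hL hAG k₁ U₁ hU₁ hα₁ hα₁3 hα₁4 h52₁ hb₁ hsmall₁ hc₃₁
    h145₁ h155₁ S T hK hd1 Reg hWa H hB₀' hH46 hc1h hε₃ h18 h2 hnest hδ₀ hB₁ hHker hq hB ev hev hBG hθW hcΔ hA₀ hAH hG190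
    hD2H0 hH0 hH h189 hqG
    (fun B' => fun x => ev x (chartH179 𝒢 W D2 H₀
      (fun Y : S → 𝔸 => Y - H (Dfix (B11Eq44Concrete.Cmap L U₁ S T K) (H : (T → 𝔸) →ₗ[ℂ] (S → 𝔸))
        ((8 * (131072 * ((d : ℝ) + 1) ^ 2) * Real.exp (4 * (800 * ((d : ℝ) + 1) ^ 2 * ((d : ℝ) + 4)) * α₁)) *
          ((L : ℝ) ^ K) ^ 2) Y)) ε₄ B'))
    (fun t => (LinearMap.pi fun x => ((ev x : (S → 𝔸) →L[ℝ] (Fin d → 𝔸)) : (S → 𝔸) →ₗ[ℝ] (Fin d → 𝔸))) ∘ₗ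
      ((fderiv ℂ (chartH179 𝒢 W D2 H₀
        (fun Y : S → 𝔸 => Y - H (Dfix (B11Eq44Concrete.Cmap L U₁ S T K) (H : (T → 𝔸) →ₗ[ℂ] (S → 𝔸))
          ((8 * (131072 * ((d : ℝ) + 1) ^ 2) * Real.exp (4 * (800 * ((d : ℝ) + 1) ^ 2 * ((d : ℝ) + 4)) * α₁)) *
            ((L : ℝ) ^ K) ^ 2) Y)) ε₄)
        ((t : ℝ) • (fun i => mlog (((avgIter L U₀ (K - dep i) (pt i) (dir i) *
          (pullIter L (avgIter L U₀ K) (dep i) (pt i) (dir i))⁻¹ : 𝔸ˣ) : 𝔸))))).restrictScalars ℝ :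
            (T → 𝔸) →ₗ[ℝ] (S → 𝔸)))
    (fun _ => rfl) (fun _ => rfl) y
  have hKc : 0 ≤ const190 1 1 b3.κ BG θW cΔ A₀ AH
      (d * Real.exp (1 / 2 * d * δ₀) *
        ((1 - (C3Gen d L * (((L : ℝ) ^ K) ^ 2 * (2 * ε₃)) * (2 * d) * B₁ * Real.exp (2 * d * δ₀)) *
            (d * B6.c0 δ₀ (1 / 2) ^ d))⁻¹ * (Real.exp (d * δ₀) * (C3Gen d L * ((L : ℝ) ^ K) ^ 2 * (2 * ε₃)))))
      (B6.c0 δ₀ (1 / 8) ^ d) :=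
    const190_nonneg' zero_le_one zero_le_one b3.κ_nonneg (c0_pow_nonneg δ₀ (1 / 8) d) hBG hθW hcΔ hA₀ hAH
      (thetaD_nonneg hε₃.le hq) hqG
  have hrow : RowSum (cubeGeometry L K S T) (α * δ₀) (B6.c0 δ₀ α ^ d) := rowSum_cubeGeometry L K S T (mul_pos hσ hδ₀)
  subst hHf
  exact dev119_le_of_ineq190_layer (boxT L K S T) (blkT L K S T) dep pt dir box blk h190 hKc
    (dist_nonneg_cubeGeometry L K S T) hrow hτ hστ y hL hd1 hAG K hU₀ hB₃ hε1 hs3 hs2 hs lo hi hlohi h317 h15 hX hfar hmv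
    hα hα3 hα4 h52 q κ hgeom hCB hbox hsmall hc₃ hsm h1 hL1

end Ineq319C

/-! ## §4 (3.7)/(3.8) at print's scale, at the concrete `C_k`: p29's (3.6) tower field on `T`, sup AND covariant-derivative output sizes -/

section Ineq38C

variable {𝔸 : Type} [CStarAlgebra 𝔸] [Nontrivial 𝔸]

variable (L : ℕ) (hL : 2 ≤ L) {G : Subgroup 𝔸ˣ} (hAG : AvgClosed d L G) (k₁ : ℕ)
  (U₁ : B7Prop1Explicit.Site d → Fin d → 𝔸ˣ) (hU₁ : ∀ x κ, U₁ x κ ∈ G) {α₁ : ℝ} (hα₁ : 0 < α₁)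
  (hα₁3 : C0 d * α₁ ≤ 1 / 3) (hα₁4 : 4 * α₁ ≤ c2' d L) (h52₁ : pdev U₁ < α₁ * (((L : ℝ) ^ k₁)⁻¹) ^ 2)
  {b₁ : ℝ} (hb₁ : 0 < b₁)
  (hsmall₁ : Real.exp (4 * (800 * ((d : ℝ) + 1) ^ 2 * ((d : ℝ) + 4)) * α₁)
    * (1 + 8 * (131072 * ((d : ℝ) + 1) ^ 2) * ((L : ℝ) ^ k₁ * b₁)) ≤ 2)
  (hc₃₁ : 4 * ((L : ℝ) ^ k₁ * b₁) < c3 d L)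
  (h145₁ : 8 * d * thetaGen d L α₁ * (L : ℝ)⁻¹ ^ 4 ≤ 1)
  (h155₁ : (2 * (L : ℝ) - 1) * (L : ℝ)⁻¹ ^ 2 + 2 * d * thetaGen d L α₁ * (L : ℝ)⁻¹ ^ 3
    + 1 / 8 * (1 + 2 * d * thetaGen d L α₁ * (L : ℝ)⁻¹ ^ 2 + 2 * d * C3Gen d L * ((L : ℝ) ^ k₁ * b₁)) * (L : ℝ)⁻¹ ^ 2 ≤ 1)
  (S T : Finset (B7Prop1Explicit.Site d × Fin d))

variable {𝒵 : Type} [NormedAddCommGroup 𝒵] [NormedSpace ℂ 𝒵] [CompleteSpace 𝒵]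
  {𝒢 : 𝒵 →L[ℂ] (S → 𝔸)} {W : (S → 𝔸) → 𝒵} {D2 : (S → 𝔸) →L[ℂ] 𝒵} {H₀ : (T → 𝔸) →L[ℂ] (S → 𝔸)} {B₀ θ C₄ a₃ 𝔧 𝔞 ε₄ : ℝ}

include hL hAG hU₁ hα₁ hα₁3 hα₁4 h52₁ hb₁ hsmall₁ hc₃₁ h145₁ h155₁ in
/-- **(3.7)/(3.8) ⇒ "Thus χ_k(□) = 1" AT PRINT'S SCALE `η = L^{−k}`, ON THE LATTICE MODEL, AT THE CONCRETE `C_k(U₁, ·)` OF [4] ON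
THE SINGLE-SCALE CUBE GEOMETRY** — r11's `B14From190LayerSizes.ineq38_lt_of_ineq190_layer_scale` (argument field `B :=` p29's
(3.6) tower field `i ↦ (1/i)log[(Q^{s*}_jV)(b_i)(M^{k−j}(U₀)(b_i))⁻¹]` of `k` levels with top field `V = V_k` and background
`U₀ = U_{k+1,□′}`, split by depth into print's `4δ_k` / `30d²L²B₃(1+β₀)ε_k` pieces there — *"On almost the whole cube □^{∼4},
except a boundary layer of the width 2M₁, the field … is equal to (1/i)log[V_k(V^{(k)}_{□′})⁻¹], hence it can be bounded by
4δ_k. On the boundary layer this field can be bounded by 30d²L²B₃(1+β₀)ε_k"* —, HERE INDEXED BY THE COARSE BONDS `T`; input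
size `supSize (cubeGeometry L k S T) boxT blkT`; output sizes `supSize … box blk` — *"|𝐇_{k,□}| … on □^∼"* — and
`covDerivBlockSize … y₀ Sc L^{−k} U₀` — *"|∇^η_{U_{k+1,□′}}𝐇_{k,□}|"* —; the one (3.2) hypothesis `h32` sizing the field AND
bounding the consumer's plaquette `p_{μν}(x)` of the finest cube) for the presented chart `𝐇 = x ↦ ev x (𝓗(B))` at the concrete
`C_k(U₁, ·)`, with BOTH pairs SUPPLIED BY NAME: `h190₀`/`hmv₀` from r08's
`B11Ineq73HasMajConcrete.ineq190_and_hmv_supSize_concreteC_kernel`, `h190₁`/`hmv₁` from r12's covariant twin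
`B11Ineq190DerivConcreteC.ineq190_and_hmv_covDerivBlockSize_concreteC_kernel`; (190), mean value, (73), (2.54), (2.61) at
`⅛δ₀`, `hN`/`hBloc`, `hTm`/`hTm0` DISCHARGED; the knit's own (2.61) at `σ = αδ₀` is `rowSum_cubeGeometry`, `hdist` is
`dist_nonneg_cubeGeometry`.  Remaining: as in §1 + the first-order compatibility letter `hev₁` and the knit's side conditions
verbatim ((3.2) `h32`, (3.3) `h33`, `δ_k = (A₁/A₀)ε_k`, (2.8) `hflow`, `2δM₂ ≥ 1`, `δ2M₂R_k ≤ τD`, the clause `h10` =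
*"for A₁/A₀ and γ sufficiently small"*, `h15`, `hX`/`hfar`/`hbox`, plaquette data, self-adjointness of the presented `𝐇`).
[cite: Balaban1988Convergent, (3.2)–(3.3) p.265, (3.6)–(3.8) p.266, (2.8) p.256; Balaban1985Variational, Prop. 9 (190) pp.308–309, (179)–(180) p.306, (73) p.289, Prop. 3 p.289, (115) p.294; Balaban1984PropagatorsII, Lemma 2.1 (2.61) p.234, (2.54) p.233] -/
theorem ineq38_lt_layer_concreteC {k : ℕ} (hk : k ≤ k₁) (hd1 : 1 ≤ d)
    (Reg : Regime 𝒢 0 W B₀ θ C₄ a₃ 𝔧 𝔞 ε₄) (hWa : AnalyticOnNhd ℂ W {Y : S → 𝔸 | ‖Y‖ < a₃})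
    (H : (T → 𝔸) →L[ℂ] (S → 𝔸)) {B₀' : ℝ} (hB₀' : 0 ≤ B₀') (hH46 : ∀ X, ‖H X‖ ≤ B₀' * ‖X‖)
    {c1h ε₃ : ℝ} (hc1h : 1 ≤ c1h) (hε₃ : 0 < ε₃)
    (h18 : 18 * ((8 * (131072 * ((d : ℝ) + 1) ^ 2) * Real.exp (4 * (800 * ((d : ℝ) + 1) ^ 2 * ((d : ℝ) + 4)) * α₁)) *
      ((L : ℝ) ^ k) ^ 2) * B₀' * d * c1h * ε₃ ≤ 1) (h2 : 2 * ε₃ ≤ b₁ / 2) (hnest : ε₄ + 𝔞 ≤ ε₃)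
    {δ₀ B₁ : ℝ} (hδ₀ : 0 < δ₀) (hB₁ : 0 ≤ B₁)
    (hHker : ∀ (c'' : T) (Y : 𝔸) (s : S),
      ‖H (Pi.single c'' Y) s‖ ≤ B₁ * Real.exp (-(δ₀ * ((B7Prop1Explicit.l1 (loK L k c''.1.1 - s.1.1) : ℝ) / (L : ℝ) ^ k))) * ‖Y‖)
    (hq : (C3Gen d L * (((L : ℝ) ^ k) ^ 2 * (2 * ε₃)) * (2 * d) * B₁ * Real.exp (2 * d * δ₀)) * (d * B6.c0 δ₀ (1 / 2) ^ d) < 1)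
    -- p29's (3.6) tower (background `U₀`, top field `V`, `k` levels) on the coarse bonds `T`; its field in the domain of (180)
    (dep : T → ℕ) (pt : T → B7Prop1Explicit.Site d) (dir : T → Fin d)
    {U₀ : B7Prop1Explicit.Site d → Fin d → 𝔸ˣ} (hU₀ : ∀ x κ, U₀ x κ ∈ G) (V : B7Prop1Explicit.Site d → Fin d → 𝔸ˣ)
    (hB : ‖H₀ (fun i => mlog (((pullIter L V (dep i) (pt i) (dir i) *
          (avgIter L U₀ (k - dep i) (pt i) (dir i))⁻¹ : 𝔸ˣ) : 𝔸)))‖ < 𝔞 ∧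
      ‖D2 (H₀ (fun i => mlog (((pullIter L V (dep i) (pt i) (dir i) *
          (avgIter L U₀ (k - dep i) (pt i) (dir i))⁻¹ : 𝔸ˣ) : 𝔸))))‖ < 𝔧)
    -- the output presentation on the cube geometry: values and first covariant derivatives
    (box : (cubeGeometry L k S T).Site → Finset (B7Prop1Explicit.Site d))
    (blk : B7Prop1Explicit.Site d → (cubeGeometry L k S T).Site)
    (y₀ : (cubeGeometry L k S T).Site) (Sc : (cubeGeometry L k S T).Site → Finset (B7Prop1Explicit.Site d × Fin d × Fin d))
    (ev : B7Prop1Explicit.Site d → ((S → 𝔸) →L[ℝ] (Fin d → 𝔸))) {b3 : BlockNorm (cubeGeometry L k S T) 𝒵}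
    (hev : ∀ (y : (cubeGeometry L k S T).Site) (v : S → 𝔸), ∀ x ∈ box y,
      ‖ev x v‖ ≤ (supSize (cubeGeometry L k S T) (boxS L k S T) (blkS L k S T) : BlockNorm (cubeGeometry L k S T) (S → 𝔸)).loc y v)
    (hev₁ : ∀ (y : (cubeGeometry L k S T).Site) (v : S → 𝔸),
      (covDerivBlockSize (cubeGeometry L k S T) y₀ Sc (((L : ℝ) ^ k)⁻¹) U₀).loc y (fun x => ev x v) ≤
        (supSize (cubeGeometry L k S T) (boxS L k S T) (blkS L k S T) : BlockNorm (cubeGeometry L k S T) (S → 𝔸)).loc y v)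
    -- the located leaves of [15] Sect. G for the abstract data on the cube sizes
    {BG θW cΔ A₀ AH : ℝ} (hBG : 0 ≤ BG) (hθW : 0 ≤ θW) (hcΔ : 0 ≤ cΔ) (hA₀ : 0 ≤ A₀) (hAH : 0 ≤ AH)
    (hG190 : HasMaj b3 (supSize (cubeGeometry L k S T) (boxS L k S T) (blkS L k S T) : BlockNorm (cubeGeometry L k S T) (S → 𝔸))
      (𝒢.restrictScalars ℝ : 𝒵 →ₗ[ℝ] (S → 𝔸)) (fun y y' => BG * Real.exp (-(δ₀ * (cubeGeometry L k S T).dist y y'))))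
    (hD2H0 : HasMaj (supSize (cubeGeometry L k S T) (boxT L k S T) (blkT L k S T) : BlockNorm (cubeGeometry L k S T) (T → 𝔸)) b3
      ((D2 ∘L H₀).restrictScalars ℝ : (T → 𝔸) →ₗ[ℝ] 𝒵) (fun y y' => cΔ * Real.exp (-(δ₀ * (cubeGeometry L k S T).dist y y'))))
    (hH0 : HasMaj (supSize (cubeGeometry L k S T) (boxT L k S T) (blkT L k S T) : BlockNorm (cubeGeometry L k S T) (T → 𝔸))
      (supSize (cubeGeometry L k S T) (boxS L k S T) (blkS L k S T) : BlockNorm (cubeGeometry L k S T) (S → 𝔸))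
      (H₀.restrictScalars ℝ : (T → 𝔸) →ₗ[ℝ] (S → 𝔸)) (fun y y' => A₀ * Real.exp (-(δ₀ * (cubeGeometry L k S T).dist y y'))))
    (hH : HasMaj (supSize (cubeGeometry L k S T) (boxT L k S T) (blkT L k S T) : BlockNorm (cubeGeometry L k S T) (T → 𝔸))
      (supSize (cubeGeometry L k S T) (boxS L k S T) (blkS L k S T) : BlockNorm (cubeGeometry L k S T) (S → 𝔸))
      (H.restrictScalars ℝ : (T → 𝔸) →ₗ[ℝ] (S → 𝔸)) (fun y y' => AH * Real.exp (-(δ₀ / 2 * (cubeGeometry L k S T).dist y y'))))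
    (h189 : ∀ B' : T → 𝔸, ‖H₀ B'‖ < 𝔞 → ‖D2 (H₀ B')‖ < 𝔧 →
      Ineq189 (supSize (cubeGeometry L k S T) (boxS L k S T) (blkS L k S T) : BlockNorm (cubeGeometry L k S T) (S → 𝔸)) b3
        ((fderiv ℂ W (solA180 𝒢 W D2 H₀ ε₄ B' + H₀ B')).restrictScalars ℝ : (S → 𝔸) →ₗ[ℝ] 𝒵) θW δ₀)
    (hqG : qG b3.κ 1 BG θW (B6.c0 δ₀ (1 / 8) ^ d) < 1)
    -- the [III] side: the letters of `B14From190LayerSizes.ineq38_lt_of_ineq190_layer_scale` minus `h190₀,₁`, `hmv₀,₁`, `hdist`, `hrow`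
    {α τ Dd B₃ δ M₂ R δk β₀ A₀' A₁ εk εk1 : ℝ}
    (hσ : 0 < α) (hτ : 0 ≤ τ) (hστ : α * δ₀ + τ ≤ δ₀ / 8) (y : (cubeGeometry L k S T).Site)
    (hε : 0 < εk) (hε' : 0 < εk1) (hflow : εk1 ≤ (1 + β₀) * εk) (hβ₀ : 0 ≤ β₀)
    (hB₃ : 1 ≤ B₃) (hδ0 : 0 ≤ δk) (hδε : δk ≤ εk)
    (hs3 : C0 d * εk1 ≤ 1 / 3) (hs2 : 2 * εk1 ≤ c2' d L) (hs : 2 * δk + 11 * (d : ℝ) ^ 2 * εk1 ≤ 1 / 6)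
    (lo hi : B7Prop1Explicit.Site d) (hlohi : lo ≤ hi)
    (h32 : pdevOn (tlo L lo k) (thi L hi k) U₀ < εk1 * ((L : ℝ)⁻¹ * ((L : ℝ) ^ k)⁻¹) ^ 2)
    (hV : ∀ x μ, V x μ ∈ U1 𝔸)
    (h15 : ∀ n, n < k → ∀ z, tlo L lo n ≤ z → z ≤ thi L hi n → ∀ r : Fin d → Fin L,
      axialFn (avgIter L U₀ (k - (n + 1))) ((L : ℤ) • z) ((L : ℤ) • z + boxVec L r) = 1)
    (hδ2 : 2 * δk ≤ 1 / 2)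
    (h33 : ∀ x ν, lo ≤ x → x + e ν ≤ hi → ‖((V x ν * (avgIter L U₀ k x ν)⁻¹ : 𝔸ˣ) : 𝔸) - 1‖ < 2 * δk)
    (hX : ∀ i, dep i ≤ k ∧ tlo L lo (dep i) ≤ pt i ∧ pt i + e (dir i) ≤ thi L hi (dep i))
    (hfar : ∀ y' i, i ∈ boxT L k S T y' → dep i ≠ 0 → Dd ≤ (cubeGeometry L k S T).dist y y')
    {Hf : B7Prop1Explicit.Site d → Fin d → 𝔸}
    (hHf : Hf = fun x => ev x (chartH179 𝒢 W D2 H₀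
      (fun Y : S → 𝔸 => Y - H (Dfix (B11Eq44Concrete.Cmap L U₁ S T k) (H : (T → 𝔸) →ₗ[ℂ] (S → 𝔸))
        ((8 * (131072 * ((d : ℝ) + 1) ^ 2) * Real.exp (4 * (800 * ((d : ℝ) + 1) ^ 2 * ((d : ℝ) + 4)) * α₁)) *
          ((L : ℝ) ^ k) ^ 2) Y)) ε₄
      (fun i => mlog (((pullIter L V (dep i) (pt i) (dir i) *
          (avgIter L U₀ (k - dep i) (pt i) (dir i))⁻¹ : 𝔸ˣ) : 𝔸)))))
    (hsa : ∀ z κ, IsSelfAdjoint (Hf z κ))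
    {u : B7Prop1Explicit.Site d → 𝔸ˣ} (hu : ∀ z, u z ∈ U1 𝔸) (μ ν : Fin d) (x : B7Prop1Explicit.Site d)
    (hgeom : 2 * δ * M₂ * R ≤ τ * Dd)
    (hCB : const190 1 1 b3.κ BG θW cΔ A₀ AH
        (d * Real.exp (1 / 2 * d * δ₀) *
          ((1 - (C3Gen d L * (((L : ℝ) ^ k) ^ 2 * (2 * ε₃)) * (2 * d) * B₁ * Real.exp (2 * d * δ₀)) *
              (d * B6.c0 δ₀ (1 / 2) ^ d))⁻¹ * (Real.exp (d * δ₀) * (C3Gen d L * ((L : ℝ) ^ k) ^ 2 * (2 * ε₃)))))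
        (B6.c0 δ₀ (1 / 8) ^ d) * B6.c0 δ₀ α ^ d ≤ B₃)
    (hδkε : δk = A₁ / A₀' * εk) (hM : 1 ≤ 2 * δ * M₂) (hR : 0 ≤ R)
    (h10 : 4 * B₃ * A₁ / A₀' + 30 * (d : ℝ) ^ 2 * (L : ℝ) ^ 2 * B₃ ^ 2 * (1 + β₀) * Real.exp (-R) < 1/10)
    (hx : x ∈ box y) (hxμ : x + e μ ∈ box y) (hxν : x + e ν ∈ box y)
    (hS₁ : (x, μ, ν) ∈ Sc y) (hS₂ : (x, ν, μ) ∈ Sc y)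
    (hε1 : εk ≤ 1) (hrestr : 2 * (1 + β₀) * (L : ℝ)⁻¹ ^ 2 + 4/10 < 1)
    -- the plaquette `p_{μν}(x)` lies in the finest cube of the tower
    (hp : PlaqIn (tlo L lo k) (thi L hi k) (x, μ, ν)) :
    ‖B8Ineq132.plaqF (gaugeAct u (B8Lemma1NonAbelian.mulCfg (B8Eq146AExpansion.expCfg
        (B8Eq146AExpansion.iEta (((L : ℝ) ^ k)⁻¹) Hf)) U₀)) μ ν x - 1‖ < εk * (((L : ℝ) ^ k)⁻¹) ^ 2 := by
  -- values: r08's end-to-end pair at the concrete `C_k`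
  obtain ⟨h190₀, hmv₀⟩ := ineq190_and_hmv_supSize_concreteC_kernel L hL hAG k₁ U₁ hU₁ hα₁ hα₁3 hα₁4 h52₁ hb₁ hsmall₁ hc₃₁
    h145₁ h155₁ S T hk hd1 Reg hWa H hB₀' hH46 hc1h hε₃ h18 h2 hnest hδ₀ hB₁ hHker hq hB ev hev hBG hθW hcΔ hA₀ hAH hG190
    hD2H0 hH0 hH h189 hqG
    (fun B' => fun x => ev x (chartH179 𝒢 W D2 H₀
      (fun Y : S → 𝔸 => Y - H (Dfix (B11Eq44Concrete.Cmap L U₁ S T k) (H : (T → 𝔸) →ₗ[ℂ] (S → 𝔸))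
        ((8 * (131072 * ((d : ℝ) + 1) ^ 2) * Real.exp (4 * (800 * ((d : ℝ) + 1) ^ 2 * ((d : ℝ) + 4)) * α₁)) *
          ((L : ℝ) ^ k) ^ 2) Y)) ε₄ B'))
    (fun t => (LinearMap.pi fun x => ((ev x : (S → 𝔸) →L[ℝ] (Fin d → 𝔸)) : (S → 𝔸) →ₗ[ℝ] (Fin d → 𝔸))) ∘ₗ
      ((fderiv ℂ (chartH179 𝒢 W D2 H₀
        (fun Y : S → 𝔸 => Y - H (Dfix (B11Eq44Concrete.Cmap L U₁ S T k) (H : (T → 𝔸) →ₗ[ℂ] (S → 𝔸))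
          ((8 * (131072 * ((d : ℝ) + 1) ^ 2) * Real.exp (4 * (800 * ((d : ℝ) + 1) ^ 2 * ((d : ℝ) + 4)) * α₁)) *
            ((L : ℝ) ^ k) ^ 2) Y)) ε₄)
        ((t : ℝ) • (fun i => mlog (((pullIter L V (dep i) (pt i) (dir i) *
          (avgIter L U₀ (k - dep i) (pt i) (dir i))⁻¹ : 𝔸ˣ) : 𝔸))))).restrictScalars ℝ :
            (T → 𝔸) →ₗ[ℝ] (S → 𝔸)))
    (fun _ => rfl) (fun _ => rfl) y
  -- covariant derivatives: r12's end-to-end pair at the concrete `C_k`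
  obtain ⟨h190₁, hmv₁⟩ := B11Ineq190DerivConcreteC.ineq190_and_hmv_covDerivBlockSize_concreteC_kernel L hL hAG k₁ U₁ hU₁ hα₁
    hα₁3 hα₁4 h52₁ hb₁ hsmall₁ hc₃₁ h145₁ h155₁ S T hk hd1 Reg hWa H hB₀' hH46 hc1h hε₃ h18 h2 hnest hδ₀ hB₁ hHker hq hB y₀ Sc
    ev hev₁ hBG hθW hcΔ hA₀ hAH hG190 hD2H0 hH0 hH h189 hqG
    (fun B' => fun x => ev x (chartH179 𝒢 W D2 H₀
      (fun Y : S → 𝔸 => Y - H (Dfix (B11Eq44Concrete.Cmap L U₁ S T k) (H : (T → 𝔸) →ₗ[ℂ] (S → 𝔸))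
        ((8 * (131072 * ((d : ℝ) + 1) ^ 2) * Real.exp (4 * (800 * ((d : ℝ) + 1) ^ 2 * ((d : ℝ) + 4)) * α₁)) *
          ((L : ℝ) ^ k) ^ 2) Y)) ε₄ B'))
    (fun t => (LinearMap.pi fun x => ((ev x : (S → 𝔸) →L[ℝ] (Fin d → 𝔸)) : (S → 𝔸) →ₗ[ℝ] (Fin d → 𝔸))) ∘ₗ
      ((fderiv ℂ (chartH179 𝒢 W D2 H₀
        (fun Y : S → 𝔸 => Y - H (Dfix (B11Eq44Concrete.Cmap L U₁ S T k) (H : (T → 𝔸) →ₗ[ℂ] (S → 𝔸))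
          ((8 * (131072 * ((d : ℝ) + 1) ^ 2) * Real.exp (4 * (800 * ((d : ℝ) + 1) ^ 2 * ((d : ℝ) + 4)) * α₁)) *
            ((L : ℝ) ^ k) ^ 2) Y)) ε₄)
        ((t : ℝ) • (fun i => mlog (((pullIter L V (dep i) (pt i) (dir i) *
          (avgIter L U₀ (k - dep i) (pt i) (dir i))⁻¹ : 𝔸ˣ) : 𝔸))))).restrictScalars ℝ :
            (T → 𝔸) →ₗ[ℝ] (S → 𝔸)))
    (fun _ => rfl) (fun _ => rfl) y
  have hKc : 0 ≤ const190 1 1 b3.κ BG θW cΔ A₀ AH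
      (d * Real.exp (1 / 2 * d * δ₀) *
        ((1 - (C3Gen d L * (((L : ℝ) ^ k) ^ 2 * (2 * ε₃)) * (2 * d) * B₁ * Real.exp (2 * d * δ₀)) *
            (d * B6.c0 δ₀ (1 / 2) ^ d))⁻¹ * (Real.exp (d * δ₀) * (C3Gen d L * ((L : ℝ) ^ k) ^ 2 * (2 * ε₃)))))
      (B6.c0 δ₀ (1 / 8) ^ d) :=
    const190_nonneg' zero_le_one zero_le_one b3.κ_nonneg (c0_pow_nonneg δ₀ (1 / 8) d) hBG hθW hcΔ hA₀ hAH
      (thetaD_nonneg hε₃.le hq) hqG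
  have hrow : RowSum (cubeGeometry L k S T) (α * δ₀) (B6.c0 δ₀ α ^ d) := rowSum_cubeGeometry L k S T (mul_pos hσ hδ₀)
  subst hHf
  exact ineq38_lt_of_ineq190_layer_scale (boxT L k S T) (blkT L k S T) dep pt dir box blk y₀ Sc h190₀ h190₁ hKc
    (dist_nonneg_cubeGeometry L k S T) hrow hτ hστ y hL hd1 hAG hU₀ hε hε' hflow hβ₀ hB₃ hδ0 hδε hs3 hs2 hs lo hi hlohi
    h32 V hV h15 hδ2 h33 hX hfar hsa hu μ ν x hmv₀ hmv₁ hgeom hCB hδkε hM hR h10 hx hxμ hxν hS₁ hS₂ hε1 hrestr hp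

end Ineq38C

end Literature.MathematicalPhysics.QuantumFieldTheory.Balaban1983to89.B14From190ConcreteC
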